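import Literature.NumberTheory.Sieve.MatomakiRadziwill
import Literature.NumberTheory.LFunctions.DirichletPolynomialMeanValue
import Literature.NumberTheory.LFunctions.TruncatedPoisson
import Literature.NumberTheory.LFunctions.LogEulerProduct
import HarnessLib

/-!
# Matomäki–Radziwiłł 2016, Lemma 14: the mis-parenthesised complex rendering is false

Topic `NumberTheory/Sieve`; sibling of `MatomakiRadziwill.lean`, which vendors the named facts of
K. Matomäki, M. Radziwiłł, *Multiplicative functions in short intervals*, Ann. of Math. 183 (2016)
(references.bib key `MatomakiRadziwillAnnals2016`).  That file renders **Lemma 14** (the Parseval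
bound, arXiv p. 15) three times: `MatomakiRadziwill2016_lemma14` (complex sequences `a : ℕ → ℂ`,
and mis-parenthesised: the `max` term sits inside the first `∫ dt`, so it carries the extra factor
`X/h₁ - (log X)^{1/15}`), `MatomakiRadziwill2016_lemma14_parseval` (complex sequences, correctly
parenthesised) and `MatomakiRadziwill2016_lemma14_real` (real sequences; the faithful reading, PROVED
in `MatomakiRadziwillLemma14.lean`).  The two complex renderings are flagged there as defective, and
`MatomakiRadziwillLemma14Refutation.lean` proves `¬ MatomakiRadziwill2016_lemma14_parseval` with the
sharp twist `a_m = m^{-iM⁴}` — a family which, as noted there, does not refute the mis-parenthesised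
rendering (the extra factor times the `max` term is not small for it).

This file **proves that the mis-parenthesised rendering is false too**,

* `MatomakiRadziwill2016_lemma14_false : ¬ MatomakiRadziwill2016_lemma14`,

with a *smoothly weighted* twist, for which the Dirichlet polynomial decays like `v⁻²` instead of
`v⁻¹` away from its peak; so the weaker fact `MatomakiRadziwill2016_lemma14` can never be discharged
or relied upon either.  (Through `MatomakiRadziwill2016_lemma14_of_parseval` this is also a second,
independent refutation of the parseval rendering.)  Since the 2026-08-15 verdict clean-up that def is
`@[deprecated]` in `MatomakiRadziwill.lean` (statement kept verbatim as the subject of this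
refutation); the refutation must name it, so the deprecation linter is silenced on exactly the
declarations below that do (`lemma14_iff`, `MatomakiRadziwill2016_lemma14_false` and its conventional
alias `not_MatomakiRadziwill2016_lemma14`).

## Why the complex statement fails

The printed lemma says "Let `|a_m| ≤ 1`" and bounds the mean square of `S₁(x)/h₁ - S₂(x)/h₂` by
`(log X)^{-2/15} + ∫_{(log X)^{1/15}}^{X/h₁} |A(1+it)|² dt + max_{T ≥ X/h₁} (X/h₁)/T ∫_T^{2T} |A(1+it)|² dt`,
`A(s) = ∑_{X ≤ m ≤ 4X} a_m m^{-s}`: only the frequencies `t ≥ (log X)^{1/15} > 0` of `A` occur.  The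
proof (arXiv p. 15) splits the Perron integral at `|t| = T₀` and then displays only `t ≥ T₀`, which is
legitimate for real `a_m` (`|A(1-it)| = |A(1+it)|`) — the only case used in the paper (§9,
`a_m = f(m) 1_𝒮(m)`).  For complex `a_m` the left-hand side also feels the frequencies `t ≤ -T₀`.

## The counterexample (all estimates elementary and explicit)

Fix a smooth plateau `g` (`= 1` on `[1.1, 2.1]`, supported in `(1.05, 2.15)`, a `ContDiffBump`),
let `λ → ∞`, `X = e^{λ⁵}` (so `log X = λ⁵`, `(log X)^{1/5} = λ`), `h₂ = X/λ`, `h₁ = X/(400λ)`,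
`L = 20λ` and `a_m = g(m/X) m^{-iL}` (`|a_m| ≤ 1`).

* *Right-hand side.* `a_m m^{-1-it} = g(m/X) m^{-1-i(t+L)}`, and for `v = t + L > 0` Euler–Maclaurin
  summation (`Literature…AFE.sum_Ioc_eq_eulerMaclaurin`) and two integrations by parts give
  `|A_X(v)| ≤ 12 B₂/v² + 3(B₁ + 1 + v)/(2X)` (`norm_Asum_le`; `B₁ ≥ |g'|`, `B₂ ≥ |g''|`).  Hence the
  integrand is `O(λ⁻⁴)` for `0 ≤ t ≤ 2λ⁵`, and for `T ≥ λ⁵` the mean value theorem for Dirichlet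
  polynomials (`dirichletPolynomial_meanSquare_le`) bounds `(X/h₁)/T ∫_T^{2T}|A|²`; altogether the
  bracket is `≤ (λ⁵)^{-2/15} + 10⁹ (B₁ + B₂ + 1)²/λ` (`rhs_integral_le`), even with the extra factor
  `X/h₁ - T₀ ≤ 400λ` that the mis-parenthesisation puts on the `max` term.
* *Left-hand side.* For `6X/5 ≤ x ≤ 2X` the windows see `g = 1`, and
  `h⁻¹ ∑_{x ≤ m ≤ x+h} m^{-iL} = x^{-iL} E(Lh/x) + O(L/x + 1/h + L h²/x²)`,
  `E(θ) = ∫_0^1 e^{-iθs} ds` (`window_approx`, from Euler–Maclaurin again); `θ₁ = Lh₁/x ≤ 1/24` gives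
  `|E(θ₁)| ≥ 23/24`, `θ₂ = Lh₂/x ≥ 10` gives `|E(θ₂)| ≤ 1/5`, so `|S₁/h₁ - S₂/h₂| ≥ 1/2` there
  (`norm_D_ge`) and the left-hand side is `≥ 1/5` (`lhs_ge`).

For every constant `C` this contradicts the asserted inequality once `λ` is large
(`eventually_good`).  Everything is proved; the main theorems use only the standard axioms.

## References

* K. Matomäki, M. Radziwiłł, *Multiplicative functions in short intervals*, Ann. of Math. (2) 183
  (2016), 1015–1056, doi:10.4007/annals.2016.183.3.6, arXiv:1501.04585 — §7, Lemma 14 and its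
  proof (arXiv p. 15).
* E. C. Titchmarsh, *The Theory of the Riemann Zeta-Function*, 2nd ed., (2.1.2) (Euler–Maclaurin
  summation, as vendored in `Literature/NumberTheory/LFunctions/TruncatedPoisson.lean`).
* A. Ivić, *The Riemann zeta-function* (1985), Thm 5.2 (mean value theorem; the explicit weak form
  `dirichletPolynomial_meanSquare_le` of `DirichletPolynomialMeanValue.lean`).
-/

noncomputable section

open Filter Finset Topology MeasureTheory Complex Real Set intervalIntegral Metric

namespace Literature.NumberTheory.Sieve

namespace MatomakiRadziwillL14Refutation

/-! ### A smooth plateau function -/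

/-- A smooth bump on `ℝ` centred at `8/5`, `= 1` on `[11/10, 21/10]`, supported in
`(21/20, 43/20)`. [folklore] -/
def bump : ContDiffBump (8 / 5 : ℝ) := ⟨1 / 2, 11 / 20, by norm_num, by norm_num⟩

/-- The plateau function `g = ⇑bump : ℝ → ℝ`. [folklore] -/
def g : ℝ → ℝ := fun u => bump u

/-- `g ≥ 0`. [folklore] -/
theorem g_nonneg (u : ℝ) : 0 ≤ g u := bump.nonneg

/-- `g ≤ 1`. [folklore] -/
theorem g_le_one (u : ℝ) : g u ≤ 1 := bump.le_one

/-- `|g| ≤ 1`. [folklore] -/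
theorem abs_g_le_one (u : ℝ) : |g u| ≤ 1 := by
  rw [abs_of_nonneg (g_nonneg u)]; exact g_le_one u

/-- The plateau: `g = 1` on `[11/10, 21/10]`. [folklore] -/
theorem g_eq_one {u : ℝ} (h1 : 11 / 10 ≤ u) (h2 : u ≤ 21 / 10) : g u = 1 := by
  apply bump.one_of_mem_closedBall
  rw [Metric.mem_closedBall, Real.dist_eq, abs_le]
  change -(1 / 2 : ℝ) ≤ u - 8 / 5 ∧ u - 8 / 5 ≤ 1 / 2
  constructor <;> linarith

/-- `g = 0` off `(21/20, 43/20)`. [folklore] -/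
theorem g_eq_zero {u : ℝ} (h : u ≤ 21 / 20 ∨ 43 / 20 ≤ u) : g u = 0 := by
  apply bump.zero_of_le_dist
  change (11 / 20 : ℝ) ≤ dist u (8 / 5)
  rw [Real.dist_eq]
  rcases h with h | h
  · rw [abs_of_nonpos (by linarith)]; linarith
  · rw [abs_of_nonneg (by linarith)]; linarith

/-- `g` is smooth. [folklore] -/
theorem g_contDiff {n : ℕ∞} : ContDiff ℝ n g := bump.contDiff

/-- `g` has compact support. [folklore] -/
theorem g_hasCompactSupport : HasCompactSupport g := bump.hasCompactSupport

/-- The topological support of `g` is `[21/20, 43/20]`. [folklore] -/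
theorem tsupport_g : tsupport g = Metric.closedBall (8 / 5 : ℝ) (11 / 20) := bump.tsupport_eq

/-- `g` is continuous. [folklore] -/
theorem g_continuous : Continuous g := bump.continuous

/-- `g` is differentiable. [folklore] -/
theorem g_differentiable : Differentiable ℝ g :=
  (g_contDiff (n := 1)).differentiable (by simp)

/-- `g' = deriv g`. [folklore] -/
theorem hasDerivAt_g (u : ℝ) : HasDerivAt g (deriv g u) u :=
  (g_differentiable u).hasDerivAt

/-- `g'` is smooth. [folklore] -/
theorem deriv_g_contDiff {n : ℕ∞} : ContDiff ℝ n (deriv g) := by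
  have h : ContDiff ℝ (⊤ : ℕ∞) g := g_contDiff
  have := ContDiff.iterate_deriv 1 h
  simpa using this.of_le (by exact_mod_cast le_top)

/-- `g'` is continuous. [folklore] -/
theorem deriv_g_continuous : Continuous (deriv g) := deriv_g_contDiff (n := 0) |>.continuous

/-- `g'` is differentiable. [folklore] -/
theorem deriv_g_differentiable : Differentiable ℝ (deriv g) :=
  (deriv_g_contDiff (n := 1)).differentiable (by simp)

/-- `g'' = deriv (deriv g)`. [folklore] -/
theorem hasDerivAt_deriv_g (u : ℝ) : HasDerivAt (deriv g) (deriv (deriv g) u) u :=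
  (deriv_g_differentiable u).hasDerivAt

/-- `g''` is continuous. [folklore] -/
theorem deriv2_g_continuous : Continuous (deriv (deriv g)) := by
  have h : ContDiff ℝ (⊤ : ℕ∞) g := g_contDiff
  have := ContDiff.iterate_deriv 2 h
  simpa using this.continuous

/-- `g' = 0` off `[21/20, 43/20]`. [folklore] -/
theorem deriv_g_eq_zero {u : ℝ} (h : u < 21 / 20 ∨ 43 / 20 < u) : deriv g u = 0 := by
  have hu : u ∉ tsupport g := by
    rw [tsupport_g, Metric.mem_closedBall, Real.dist_eq, not_le]
    rcases h with h | h
    · rw [abs_of_nonpos (by linarith)]; linarith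
    · rw [abs_of_nonneg (by linarith)]; linarith
  exact Function.notMem_support.mp fun hs => hu (support_deriv_subset hs)

/-- Bounds `B₁ ≥ |g'|`, `B₂ ≥ |g''|` (both derivatives are continuous with compact support).
[folklore] -/
theorem exists_deriv_bounds :
    ∃ B₁ B₂ : ℝ, 0 ≤ B₁ ∧ 0 ≤ B₂ ∧ (∀ u, |deriv g u| ≤ B₁) ∧ ∀ u, |deriv (deriv g) u| ≤ B₂ := by
  obtain ⟨B₁, hB₁⟩ := deriv_g_continuous.bounded_above_of_compact_support g_hasCompactSupport.deriv
  obtain ⟨B₂, hB₂⟩ :=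
    deriv2_g_continuous.bounded_above_of_compact_support g_hasCompactSupport.deriv.deriv
  refine ⟨B₁, B₂, (abs_nonneg _).trans (hB₁ 0), (abs_nonneg _).trans (hB₂ 0), fun u => ?_,
    fun u => ?_⟩
  · simpa [Real.norm_eq_abs] using hB₁ u
  · simpa [Real.norm_eq_abs] using hB₂ u

/-! ### Euler–Maclaurin summation, norm form -/

open Literature.NumberTheory.LFunctions.AFE in
/-- **Euler–Maclaurin, order one, as an inequality**: for `0 ≤ a ≤ b` and `φ` continuously
differentiable on `[a, b]` with `‖φ'‖ ≤ M`,
`‖∑_{a < n ≤ b} φ(n) - ∫_a^b φ‖ ≤ (M/2)(b - a) + (‖φ(a)‖ + ‖φ(b)‖)/2`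
(from Titchmarsh (2.1.2), `sum_Ioc_eq_eulerMaclaurin`, and `|ψ| ≤ 1/2`).
[cite: Titchmarsh1986, eq. (2.1.2)] -/
theorem norm_sum_Ioc_sub_integral_le {a b : ℝ} (ha : 0 ≤ a) (hab : a ≤ b) {φ φ' : ℝ → ℂ}
    (hφ : ∀ t ∈ Icc a b, HasDerivAt φ (φ' t) t) (hφ'c : ContinuousOn φ' (Icc a b))
    {M : ℝ} (hM : ∀ t ∈ Icc a b, ‖φ' t‖ ≤ M) :
    ‖∑ n ∈ Finset.Ioc ⌊a⌋₊ ⌊b⌋₊, φ n - ∫ x in a..b, φ x‖ ≤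
      M / 2 * (b - a) + (‖φ a‖ + ‖φ b‖) / 2 := by
  rw [sum_Ioc_eq_eulerMaclaurin ha hab hφ hφ'c]
  have h1 : ‖∫ x in a..b, (saw x : ℂ) * φ' x‖ ≤ M / 2 * |b - a| := by
    refine intervalIntegral.norm_integral_le_of_norm_le_const fun x hx => ?_
    rw [Set.uIoc_of_le hab] at hx
    rw [norm_mul, Complex.norm_real, Real.norm_eq_abs]
    have h2 := abs_saw_le x
    have h3 := hM x ⟨hx.1.le, hx.2⟩
    calc |saw x| * ‖φ' x‖ ≤ (1 / 2) * M :=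
          mul_le_mul h2 h3 (norm_nonneg _) (by norm_num)
      _ = M / 2 := by ring
  rw [abs_of_nonneg (sub_nonneg.2 hab)] at h1
  have hsaw : ∀ y : ℝ, ‖(saw y : ℂ) * φ y‖ ≤ ‖φ y‖ / 2 := fun y => by
    rw [norm_mul, Complex.norm_real, Real.norm_eq_abs]
    have := abs_saw_le y
    nlinarith [norm_nonneg (φ y)]
  calc ‖(∫ x in a..b, φ x) + (∫ x in a..b, (saw x : ℂ) * φ' x) + (saw a : ℂ) * φ a
          - (saw b : ℂ) * φ b - ∫ x in a..b, φ x‖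
      = ‖(∫ x in a..b, (saw x : ℂ) * φ' x) + (saw a : ℂ) * φ a - (saw b : ℂ) * φ b‖ := by
        ring_nf
    _ ≤ ‖(∫ x in a..b, (saw x : ℂ) * φ' x) + (saw a : ℂ) * φ a‖ + ‖(saw b : ℂ) * φ b‖ :=
        norm_sub_le _ _
    _ ≤ ‖∫ x in a..b, (saw x : ℂ) * φ' x‖ + ‖(saw a : ℂ) * φ a‖ + ‖(saw b : ℂ) * φ b‖ := by
        gcongr; exact norm_add_le _ _
    _ ≤ M / 2 * (b - a) + ‖φ a‖ / 2 + ‖φ b‖ / 2 := by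
        gcongr
        · exact hsaw a
        · exact hsaw b
    _ = M / 2 * (b - a) + (‖φ a‖ + ‖φ b‖) / 2 := by ring

/-- The integers of `[x, N]` versus those of `(⌊x⌋, N]`: the two sums differ at most by the term
`n = ⌊x⌋` (present exactly when `x` is an integer). [folklore] -/
theorem norm_sum_Icc_ceil_sub_sum_Ioc_floor_le (x : ℝ) (N : ℕ) (f : ℕ → ℂ) :
    ‖∑ n ∈ Finset.Icc ⌈x⌉₊ N, f n - ∑ n ∈ Finset.Ioc ⌊x⌋₊ N, f n‖ ≤ ‖f ⌊x⌋₊‖ := by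
  have hsub : Finset.Ioc ⌊x⌋₊ N ⊆ Finset.Icc ⌈x⌉₊ N := by
    intro n hn
    rw [Finset.mem_Ioc] at hn
    rw [Finset.mem_Icc]
    exact ⟨(Nat.ceil_le_floor_add_one x).trans hn.1, hn.2⟩
  rw [← Finset.sum_sdiff hsub, add_sub_cancel_right]
  have hdiff : Finset.Icc ⌈x⌉₊ N \ Finset.Ioc ⌊x⌋₊ N ⊆ {⌊x⌋₊} := by
    intro n hn
    rw [Finset.mem_sdiff, Finset.mem_Icc, Finset.mem_Ioc, not_and_or, not_lt] at hn
    rw [Finset.mem_singleton]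
    obtain ⟨⟨h1, h2⟩, h3 | h3⟩ := hn
    · have h4 : ⌊x⌋₊ ≤ ⌈x⌉₊ := Nat.floor_le_ceil x
      omega
    · exact absurd h2 h3
  rcases Finset.subset_singleton_iff.mp hdiff with h | h
  · rw [h, Finset.sum_empty, norm_zero]; exact norm_nonneg _
  · rw [h, Finset.sum_singleton]

/-! ### Calculus of `y ↦ (y : ℂ) ^ c` on `(0, ∞)` -/

/-- `d/dy y^c = c y^{c-1}` at `u > 0` (real variable, complex exponent `c ≠ 0`). [folklore] -/
theorem hasDerivAt_ofReal_cpow {u : ℝ} (hu : 0 < u) {c : ℂ} (hc : c ≠ 0) :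
    HasDerivAt (fun y : ℝ => (y : ℂ) ^ c) (c * (u : ℂ) ^ (c - 1)) u :=
  hasDerivAt_ofReal_cpow_const hu.ne' hc

/-- `y ↦ y^c` is continuous at every `u > 0`. [folklore] -/
theorem continuousAt_ofReal_cpow {u : ℝ} (hu : 0 < u) (c : ℂ) :
    ContinuousAt (fun y : ℝ => (y : ℂ) ^ c) u := by
  rcases eq_or_ne c 0 with rfl | hc
  · simp only [cpow_zero]; exact continuousAt_const
  · exact (hasDerivAt_ofReal_cpow hu hc).continuousAt

/-- `y ↦ y^c` is continuous on every set of positive reals. [folklore] -/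
theorem continuousOn_ofReal_cpow (c : ℂ) {s : Set ℝ} (hs : ∀ u ∈ s, 0 < u) :
    ContinuousOn (fun y : ℝ => (y : ℂ) ^ c) s :=
  fun u hu => (continuousAt_ofReal_cpow (hs u hu) c).continuousWithinAt

/-- `|v| ≤ |1 - iv|`. [folklore] -/
theorem abs_le_norm_one_sub_mul_I (v : ℝ) : |v| ≤ ‖(1 : ℂ) - v * I‖ := by
  have h := Complex.abs_im_le_norm ((1 : ℂ) - v * I)
  simpa using h

/-! ### The oscillatory integral `J(v) = ∫_1^4 g(u) u^{-1-iv} du` -/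

/-- `J(v) = ∫_1^4 g(u) u^{-(1+iv)} du`. [folklore] -/
def J (v : ℝ) : ℂ := ∫ u in (1 : ℝ)..4, (g u : ℂ) * (u : ℂ) ^ (-(1 + v * I))

/-- Two integrations by parts: `‖J(v)‖ ≤ 12 B₂ / v²` (`B₂ ≥ |g''|`), the boundary terms vanishing
because `g` and `g'` vanish at `1` and `4`. [folklore] -/
theorem norm_J_le {B₂ : ℝ} (hB₂ : ∀ u, |deriv (deriv g) u| ≤ B₂) {v : ℝ} (hv : v ≠ 0) :
    ‖J v‖ ≤ 12 * B₂ / v ^ 2 := by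
  have hB₂0 : 0 ≤ B₂ := (abs_nonneg _).trans (hB₂ 0)
  have hvI : (v : ℂ) * I ≠ 0 := mul_ne_zero (ofReal_ne_zero.2 hv) I_ne_zero
  have hc1 : (-(v * I) : ℂ) ≠ 0 := neg_ne_zero.2 hvI
  have hc2 : (1 - v * I : ℂ) ≠ 0 := by
    intro h; have := congrArg Complex.re h; simp at this
  have h14 : (1 : ℝ) ≤ 4 := by norm_num
  have hpos : ∀ x ∈ Set.uIcc (1 : ℝ) 4, 0 < x := by
    intro x hx; rw [Set.uIcc_of_le h14] at hx; linarith [hx.1]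
  -- first integration by parts
  set v₁ : ℝ → ℂ := fun x => (x : ℂ) ^ (-(v * I)) / (-(v * I)) with hv₁
  have hdv₁ : ∀ x ∈ Set.uIcc (1 : ℝ) 4, HasDerivAt v₁ ((x : ℂ) ^ (-(1 + v * I))) x := by
    intro x hx
    have h := (hasDerivAt_ofReal_cpow (hpos x hx) hc1).div_const (-(v * I))
    refine h.congr_deriv ?_
    rw [mul_div_cancel_left₀ _ hc1]
    congr 1; ring
  have hu : ∀ x ∈ Set.uIcc (1 : ℝ) 4, HasDerivAt (fun x => (g x : ℂ)) ((deriv g x : ℝ) : ℂ) x :=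
    fun x _ => (hasDerivAt_g x).ofReal_comp
  have hu'int : IntervalIntegrable (fun x => ((deriv g x : ℝ) : ℂ)) volume (1 : ℝ) 4 :=
    (continuous_ofReal.comp deriv_g_continuous).intervalIntegrable _ _
  have hv'int : IntervalIntegrable (fun x : ℝ => (x : ℂ) ^ (-(1 + v * I))) volume (1 : ℝ) 4 :=
    (continuousOn_ofReal_cpow _ hpos).intervalIntegrable
  have step1 := intervalIntegral.integral_mul_deriv_eq_deriv_mul hu hdv₁ hu'int hv'int
  have hg1 : g 1 = 0 := g_eq_zero (Or.inl (by norm_num))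
  have hg4 : g 4 = 0 := g_eq_zero (Or.inr (by norm_num))
  -- second integration by parts
  set v₂ : ℝ → ℂ := fun x => (x : ℂ) ^ (1 - v * I) / (1 - v * I) with hv₂
  have hdv₂ : ∀ x ∈ Set.uIcc (1 : ℝ) 4, HasDerivAt v₂ ((x : ℂ) ^ (-(v * I))) x := by
    intro x hx
    have h := (hasDerivAt_ofReal_cpow (hpos x hx) hc2).div_const (1 - v * I)
    refine h.congr_deriv ?_
    rw [mul_div_cancel_left₀ _ hc2]
    congr 1; ring
  have hu₂ : ∀ x ∈ Set.uIcc (1 : ℝ) 4,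
      HasDerivAt (fun x => ((deriv g x : ℝ) : ℂ)) ((deriv (deriv g) x : ℝ) : ℂ) x :=
    fun x _ => (hasDerivAt_deriv_g x).ofReal_comp
  have hu₂'int : IntervalIntegrable (fun x => ((deriv (deriv g) x : ℝ) : ℂ)) volume (1 : ℝ) 4 :=
    (continuous_ofReal.comp deriv2_g_continuous).intervalIntegrable _ _
  have hv₂'int : IntervalIntegrable (fun x : ℝ => (x : ℂ) ^ (-(v * I))) volume (1 : ℝ) 4 :=
    (continuousOn_ofReal_cpow _ hpos).intervalIntegrable
  have step2 := intervalIntegral.integral_mul_deriv_eq_deriv_mul hu₂ hdv₂ hu₂'int hv₂'int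
  have hdg1 : deriv g 1 = 0 := deriv_g_eq_zero (Or.inl (by norm_num))
  have hdg4 : deriv g 4 = 0 := deriv_g_eq_zero (Or.inr (by norm_num))
  -- the last integral
  have hK : ‖∫ x in (1 : ℝ)..4, ((deriv (deriv g) x : ℝ) : ℂ) * v₂ x‖ ≤
      4 * B₂ / ‖(1 : ℂ) - v * I‖ * |4 - 1| := by
    refine intervalIntegral.norm_integral_le_of_norm_le_const fun x hx => ?_
    rw [Set.uIoc_of_le h14] at hx
    have hx0 : 0 < x := by linarith [hx.1]
    have hn2 : ‖v₂ x‖ = x / ‖(1 : ℂ) - v * I‖ := by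
      simp only [hv₂]
      rw [norm_div, Complex.norm_cpow_eq_rpow_re_of_pos hx0]
      simp
    rw [norm_mul, Complex.norm_real, Real.norm_eq_abs, hn2]
    have hnpos : 0 < ‖(1 : ℂ) - v * I‖ := norm_pos_iff.2 hc2
    rw [mul_div_assoc']
    rw [div_le_div_iff_of_pos_right hnpos]
    calc |deriv (deriv g) x| * x ≤ B₂ * 4 :=
          mul_le_mul (hB₂ x) hx.2 hx0.le hB₂0
      _ = 4 * B₂ := by ring
  -- assemble
  have hJ : J v = (∫ x in (1 : ℝ)..4, ((deriv (deriv g) x : ℝ) : ℂ) * v₂ x) / (-(v * I)) := by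
    have e1 : J v = -∫ x in (1 : ℝ)..4, ((deriv g x : ℝ) : ℂ) * v₁ x := by
      unfold J
      rw [step1, hg1, hg4]
      simp
    have e2 : ∫ x in (1 : ℝ)..4, ((deriv g x : ℝ) : ℂ) * v₁ x =
        (∫ x in (1 : ℝ)..4, ((deriv g x : ℝ) : ℂ) * (x : ℂ) ^ (-(v * I))) / (-(v * I)) := by
      rw [← intervalIntegral.integral_div]
      refine intervalIntegral.integral_congr fun x _ => ?_
      simp only [hv₁]; ring
    have e3 : ∫ x in (1 : ℝ)..4, ((deriv g x : ℝ) : ℂ) * (x : ℂ) ^ (-(v * I)) =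
        -∫ x in (1 : ℝ)..4, ((deriv (deriv g) x : ℝ) : ℂ) * v₂ x := by
      rw [step2, hdg1, hdg4]
      simp
    rw [e1, e2, e3]
    ring
  rw [hJ, norm_div, norm_neg, norm_mul, Complex.norm_real, Complex.norm_I, mul_one,
    Real.norm_eq_abs]
  have hv0 : 0 < |v| := abs_pos.2 hv
  have hnorm : |v| ≤ ‖(1 : ℂ) - v * I‖ := abs_le_norm_one_sub_mul_I v
  have hnpos : 0 < ‖(1 : ℂ) - v * I‖ := hv0.trans_le hnorm
  rw [show |(4 : ℝ) - 1| = 3 by norm_num] at hK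
  have hK' : ‖∫ x in (1 : ℝ)..4, ((deriv (deriv g) x : ℝ) : ℂ) * v₂ x‖ ≤
      12 * B₂ / ‖(1 : ℂ) - v * I‖ := by
    rw [show 12 * B₂ / ‖(1 : ℂ) - v * I‖ = 4 * B₂ / ‖(1 : ℂ) - ↑v * I‖ * 3 by ring]
    exact hK
  calc ‖∫ x in (1 : ℝ)..4, ((deriv (deriv g) x : ℝ) : ℂ) * v₂ x‖ / |v|
      ≤ (12 * B₂ / ‖(1 : ℂ) - v * I‖) / |v| := by gcongr
    _ ≤ (12 * B₂ / |v|) / |v| := by gcongr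
    _ = 12 * B₂ / v ^ 2 := by rw [div_div, ← sq_abs v, sq]

/-! ### The Dirichlet polynomial of the counterexample at `1 + iv` -/

/-- `A_X(v) = ∑_{X ≤ m ≤ 4X} g(m/X) m^{-(1+iv)}`. [folklore] -/
def Asum (X v : ℝ) : ℂ :=
  ∑ m ∈ Finset.Icc ⌈X⌉₊ ⌊4 * X⌋₊, (g (m / X) : ℂ) * (m : ℂ) ^ (-(1 + v * I))

/-- **Decay of `A_X(v)`**: `‖A_X(v)‖ ≤ 12 B₂ / v² + 3 (B₁ + 1 + v) / (2X)` for `v > 0`, `X ≥ 1`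
(Euler–Maclaurin summation over `[X, 4X]`, then the substitution `y = Xu` and `norm_J_le`).
[folklore] -/
theorem norm_Asum_le {B₁ B₂ : ℝ} (hB₁ : ∀ u, |deriv g u| ≤ B₁)
    (hB₂ : ∀ u, |deriv (deriv g) u| ≤ B₂) {X : ℝ} (hX : 1 ≤ X) {v : ℝ} (hv : 0 < v) :
    ‖Asum X v‖ ≤ 12 * B₂ / v ^ 2 + 3 * (B₁ + 1 + v) / (2 * X) := by
  have hX0 : 0 < X := by linarith
  have hB₁0 : 0 ≤ B₁ := (abs_nonneg _).trans (hB₁ 0)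
  have hc0 : (-(1 + (v : ℂ) * I)) ≠ 0 := by
    intro h; have := congrArg Complex.re h; simp at this
  have hcre : (-(1 + (v : ℂ) * I)).re = -1 := by simp
  have hc1re : (-(1 + (v : ℂ) * I) - 1).re = -2 := by simp; norm_num
  have hnc' : ‖-(1 + (v : ℂ) * I)‖ ≤ 1 + v := by
    rw [norm_neg]
    calc ‖(1 : ℂ) + v * I‖ ≤ ‖(1 : ℂ)‖ + ‖(v : ℂ) * I‖ := norm_add_le _ _
      _ = 1 + v := by simp [abs_of_pos hv]
  set c : ℂ := -(1 + v * I) with hc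
  -- the summand as a function of a real variable, and its derivative
  set φ : ℝ → ℂ := fun y => (g (y / X) : ℂ) * (y : ℂ) ^ c with hφ
  set φ' : ℝ → ℂ := fun y =>
    ((deriv g (y / X) / X : ℝ) : ℂ) * (y : ℂ) ^ c + (g (y / X) : ℂ) * (c * (y : ℂ) ^ (c - 1))
    with hφ'
  have hderiv : ∀ y, 0 < y → HasDerivAt φ (φ' y) y := by
    intro y hy
    have h0 : HasDerivAt (fun y => g (y / X)) (deriv g (y / X) / X) y := by
      have := (hasDerivAt_g (y / X)).comp y ((hasDerivAt_id y).div_const X)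
      simpa [Function.comp_def, div_eq_mul_inv] using this
    exact h0.ofReal_comp.mul (hasDerivAt_ofReal_cpow hy hc0)
  have hφ'cont : ContinuousOn φ' (Icc X (4 * X)) := by
    have hpos : ∀ y ∈ Icc X (4 * X), 0 < y := fun y hy => hX0.trans_le hy.1
    apply ContinuousOn.add
    · refine ContinuousOn.mul ?_ (continuousOn_ofReal_cpow c hpos)
      exact (continuous_ofReal.comp ((deriv_g_continuous.comp
        (continuous_id.div_const X)).div_const X)).continuousOn
    · refine ContinuousOn.mul ?_ (continuousOn_const.mul (continuousOn_ofReal_cpow _ hpos))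
      exact (continuous_ofReal.comp (g_continuous.comp (continuous_id.div_const X))).continuousOn
  -- the derivative bound on `[X, 4X]`
  have hφ'le : ∀ y ∈ Icc X (4 * X), ‖φ' y‖ ≤ (B₁ + 1 + v) / X ^ 2 := by
    intro y hy
    have hy0 : 0 < y := hX0.trans_le hy.1
    have hn1 : ‖(y : ℂ) ^ c‖ = y⁻¹ := by rw [Complex.norm_cpow_eq_rpow_re_of_pos hy0, hcre, Real.rpow_neg_one]
    have hn2 : ‖(y : ℂ) ^ (c - 1)‖ = (y ^ 2)⁻¹ := by
      rw [Complex.norm_cpow_eq_rpow_re_of_pos hy0, hc1re, Real.rpow_neg hy0.le, Real.rpow_two]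
    have hyinv : y⁻¹ ≤ X⁻¹ := inv_anti₀ hX0 hy.1
    have hy2inv : (y ^ 2)⁻¹ ≤ (X ^ 2)⁻¹ := inv_anti₀ (by positivity) (by nlinarith [hy.1])
    have hXinv : X⁻¹ ≤ 1 := inv_le_one_of_one_le₀ hX
    calc ‖φ' y‖ ≤ ‖((deriv g (y / X) / X : ℝ) : ℂ) * (y : ℂ) ^ c‖
          + ‖(g (y / X) : ℂ) * (c * (y : ℂ) ^ (c - 1))‖ := norm_add_le _ _
      _ = |deriv g (y / X)| / X * y⁻¹ + |g (y / X)| * (‖c‖ * (y ^ 2)⁻¹) := by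
          rw [norm_mul, norm_mul, norm_mul, Complex.norm_real, Complex.norm_real, hn1, hn2,
            Real.norm_eq_abs, Real.norm_eq_abs, abs_div, abs_of_pos hX0]
      _ ≤ B₁ / X * X⁻¹ + 1 * ((1 + v) * (X ^ 2)⁻¹) := by
          apply add_le_add
          · exact mul_le_mul (div_le_div_of_nonneg_right (hB₁ _) hX0.le) hyinv
              (inv_nonneg.2 hy0.le) (div_nonneg hB₁0 hX0.le)
          · refine mul_le_mul (abs_g_le_one _) ?_ (by positivity) zero_le_one
            exact mul_le_mul hnc' hy2inv (by positivity) (by positivity)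
      _ = (B₁ + 1 + v) / X ^ 2 := by field_simp; ring
  -- Euler–Maclaurin over `[X, 4X]`
  have hX4 : X ≤ 4 * X := by linarith
  have hEM := norm_sum_Ioc_sub_integral_le hX0.le hX4 (fun y hy => hderiv y (hX0.trans_le hy.1))
    hφ'cont hφ'le
  have hφX : φ X = 0 := by
    simp only [hφ, div_self hX0.ne']
    rw [g_eq_zero (Or.inl (by norm_num))]; simp
  have hφ4X : φ (4 * X) = 0 := by
    simp only [hφ]
    rw [show 4 * X / X = 4 by field_simp, g_eq_zero (Or.inr (by norm_num))]; simp
  rw [hφX, hφ4X, norm_zero, add_zero, zero_div, add_zero] at hEM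
  -- the sum over `Icc ⌈X⌉ ⌊4X⌋` is the sum over `Ioc ⌊X⌋ ⌊4X⌋`
  have hsum : Asum X v = ∑ n ∈ Finset.Ioc ⌊X⌋₊ ⌊4 * X⌋₊, φ n := by
    have h := norm_sum_Icc_ceil_sub_sum_Ioc_floor_le X ⌊4 * X⌋₊ (fun n => φ n)
    have h0 : φ (⌊X⌋₊ : ℕ) = 0 := by
      simp only [hφ]
      have : (⌊X⌋₊ : ℝ) / X ≤ 1 := by
        rw [div_le_one hX0]; exact Nat.floor_le hX0.le
      rw [g_eq_zero (Or.inl (by linarith))]; simp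
    rw [h0, norm_zero] at h
    have h' := norm_le_zero_iff.mp h
    rw [sub_eq_zero] at h'
    rw [← h']
    rfl
  -- the integral: substitution `y = X u`
  have hint : ∫ y in X..4 * X, φ y = ((X : ℂ) * (X : ℂ) ^ c) * J v := by
    have hsub := intervalIntegral.smul_integral_comp_mul_left (f := φ) (a := 1) (b := 4) X
    rw [mul_one, mul_comm X 4] at hsub
    rw [← hsub, Complex.real_smul, mul_assoc]
    congr 1
    unfold J
    rw [← intervalIntegral.integral_const_mul]
    refine intervalIntegral.integral_congr fun u hu => ?_
    rw [Set.uIcc_of_le (by norm_num : (1 : ℝ) ≤ 4)] at hu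
    have hu0 : 0 ≤ u := by linarith [hu.1]
    simp only [hφ]
    rw [show X * u / X = u by field_simp, Complex.ofReal_mul,
      Complex.mul_cpow_ofReal_nonneg hX0.le hu0]
    ring
  have hnint : ‖∫ y in X..4 * X, φ y‖ = ‖J v‖ := by
    rw [hint, norm_mul, norm_mul, Complex.norm_real, Complex.norm_cpow_eq_rpow_re_of_pos hX0, hcre,
      Real.rpow_neg_one, Real.norm_eq_abs, abs_of_pos hX0, mul_inv_cancel₀ hX0.ne', one_mul]
  -- conclusion
  calc ‖Asum X v‖ = ‖(∑ n ∈ Finset.Ioc ⌊X⌋₊ ⌊4 * X⌋₊, φ n - ∫ y in X..4 * X, φ y)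
        + ∫ y in X..4 * X, φ y‖ := by rw [hsum, sub_add_cancel]
    _ ≤ ‖∑ n ∈ Finset.Ioc ⌊X⌋₊ ⌊4 * X⌋₊, φ n - ∫ y in X..4 * X, φ y‖
        + ‖∫ y in X..4 * X, φ y‖ := norm_add_le _ _
    _ ≤ (B₁ + 1 + v) / X ^ 2 / 2 * (4 * X - X) + ‖J v‖ := by rw [hnint]; linarith [hEM]
    _ ≤ (B₁ + 1 + v) / X ^ 2 / 2 * (4 * X - X) + 12 * B₂ / v ^ 2 := by
        have := norm_J_le hB₂ hv.ne'; linarith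
    _ = 12 * B₂ / v ^ 2 + 3 * (B₁ + 1 + v) / (2 * X) := by field_simp; ring

/-! ### The counterexample sequence and the right-hand side of Lemma 14 -/

/-- The test sequence `a_m = g(m/X) m^{-iL}`. [folklore] -/
def aSeq (X L : ℝ) (m : ℕ) : ℂ := (g (m / X) : ℂ) * (m : ℂ) ^ (-((L : ℂ) * I))

/-- `|a_m| ≤ 1`. [folklore] -/
theorem norm_aSeq_le (X L : ℝ) (m : ℕ) : ‖aSeq X L m‖ ≤ 1 := by
  unfold aSeq
  rw [norm_mul, Complex.norm_real, Real.norm_eq_abs]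
  rcases Nat.eq_zero_or_pos m with rfl | hm
  · rcases eq_or_ne (-((L : ℂ) * I)) 0 with h0 | h0
    · rw [h0, cpow_zero, norm_one, mul_one]; exact abs_g_le_one _
    · simp only [Nat.cast_zero]
      rw [Complex.zero_cpow h0, norm_zero, mul_zero]; exact zero_le_one
  · have : ‖(m : ℂ) ^ (-((L : ℂ) * I))‖ = 1 := by
      rw [show (m : ℂ) = ((m : ℝ) : ℂ) by simp, Complex.norm_cpow_eq_rpow_re_of_pos (by exact_mod_cast hm)]
      simp
    rw [this, mul_one]; exact abs_g_le_one _

/-- `a_m m^{-(1+it)} = g(m/X) m^{-(1+i(t+L))}` (`m ≥ 1`). [folklore] -/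
theorem aSeq_mul_cpow (X L : ℝ) {m : ℕ} (hm : m ≠ 0) (t : ℝ) :
    aSeq X L m * (m : ℂ) ^ (-(1 + (t : ℂ) * I)) =
      (g (m / X) : ℂ) * (m : ℂ) ^ (-(1 + ((t + L : ℝ) : ℂ) * I)) := by
  unfold aSeq
  have hm0 : (m : ℂ) ≠ 0 := Nat.cast_ne_zero.2 hm
  rw [mul_assoc, ← Complex.cpow_add _ _ hm0]
  congr 2
  push_cast; ring

/-- `N_a(X, t) = ‖∑_{X ≤ m ≤ 4X} a_m m^{-(1+it)}‖²`, the integrand on the right of Lemma 14.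
[cite: MatomakiRadziwillAnnals2016, Lemma 14] -/
def Nsq (a : ℕ → ℂ) (X t : ℝ) : ℝ :=
  ‖∑ m ∈ Finset.Icc ⌈X⌉₊ ⌊4 * X⌋₊, a m * (m : ℂ) ^ (-(1 + (t : ℂ) * I))‖ ^ 2

/-- The `max` term of Lemma 14, `⨆_{T ≥ X/h₁} (X/h₁)/T ∫_T^{2T} N_a(X, t) dt`.
[cite: MatomakiRadziwillAnnals2016, Lemma 14] -/
def Smax (a : ℕ → ℂ) (X h₁ : ℝ) : ℝ :=
  ⨆ T : Set.Ici (X / h₁), (X / h₁) / (T : ℝ) * ∫ t in (T : ℝ)..2 * T, Nsq a X t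

/-- `N ≥ 0`. [folklore] -/
theorem Nsq_nonneg (a : ℕ → ℂ) (X t : ℝ) : 0 ≤ Nsq a X t := sq_nonneg _

/-- For the test sequence, `N(X, t) = ‖A_X(t + L)‖²`. [folklore] -/
theorem Nsq_aSeq {X : ℝ} (hX : 0 < X) (L t : ℝ) : Nsq (aSeq X L) X t = ‖Asum X (t + L)‖ ^ 2 := by
  unfold Nsq Asum
  congr 2
  refine Finset.sum_congr rfl fun m hm => ?_
  rw [Finset.mem_Icc] at hm
  have hm1 : 1 ≤ ⌈X⌉₊ := Nat.one_le_iff_ne_zero.2 (by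
    intro h; rw [Nat.ceil_eq_zero] at h; linarith)
  rw [aSeq_mul_cpow X L (by omega) t]

/-- Pointwise decay of the integrand for the test sequence (`t ≥ 0`, `L > 0`, `X ≥ 1`):
`N(X, t) ≤ (12 B₂/(t+L)² + 3(B₁ + 1 + t + L)/(2X))²`. [folklore] -/
theorem Nsq_aSeq_le {B₁ B₂ : ℝ} (hB₁ : ∀ u, |deriv g u| ≤ B₁)
    (hB₂ : ∀ u, |deriv (deriv g) u| ≤ B₂) {X : ℝ} (hX : 1 ≤ X) {L t : ℝ} (hL : 0 < L)
    (ht : 0 ≤ t) :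
    Nsq (aSeq X L) X t ≤ (12 * B₂ / (t + L) ^ 2 + 3 * (B₁ + 1 + (t + L)) / (2 * X)) ^ 2 := by
  rw [Nsq_aSeq (by linarith) L t]
  have h := norm_Asum_le hB₁ hB₂ hX (v := t + L) (by linarith)
  exact pow_le_pow_left₀ (norm_nonneg _) h 2

/-- The integrand is continuous in `t`. [folklore] -/
theorem continuous_Nsq (a : ℕ → ℂ) {X : ℝ} (hX : 0 < X) : Continuous fun t : ℝ => Nsq a X t := by
  unfold Nsq
  refine ((continuous_finsetSum _ fun m hm => ?_).norm).pow 2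
  rw [Finset.mem_Icc] at hm
  have hm1 : 1 ≤ ⌈X⌉₊ := Nat.one_le_iff_ne_zero.2 (by
    intro h; rw [Nat.ceil_eq_zero] at h; linarith)
  have hm0 : (m : ℂ) ≠ 0 := Nat.cast_ne_zero.2 (by omega)
  exact continuous_const.mul (Continuous.const_cpow (by fun_prop) (Or.inl hm0))

/-- **Mean value theorem input** (from `dirichletPolynomial_meanSquare_le`): for `‖a_m‖ ≤ 1`,
`X ≥ 1` and `T > 0`, `∫_T^{2T} N_a(X, t) dt ≤ (10T + 72X) · 4/X` (the coefficients `a_m/m`,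
`X ≤ m ≤ 4X`, have `∑ |a_m/m|² ≤ 4X/X²`). [cite: Ivic1985, Theorem 5.2 (weak form)] -/
theorem integral_Nsq_le_mvt (a : ℕ → ℂ) (ha : ∀ m, ‖a m‖ ≤ 1) {X : ℝ} (hX : 1 ≤ X) {T : ℝ}
    (hT : 0 < T) : ∫ t in T..2 * T, Nsq a X t ≤ (10 * T + 72 * X) * (4 / X) := by
  have hX0 : 0 < X := by linarith
  set N := ⌊4 * X⌋₊ with hN
  have hceil : 1 ≤ ⌈X⌉₊ := Nat.one_le_iff_ne_zero.2 (by
    intro h; rw [Nat.ceil_eq_zero] at h; linarith)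
  set b : ℕ → ℂ := fun n => if ⌈X⌉₊ ≤ n then a n * (n : ℂ)⁻¹ else 0 with hb
  -- the identity with a Dirichlet polynomial over `Icc 1 N`
  have hid : ∀ t : ℝ, ∑ m ∈ Finset.Icc ⌈X⌉₊ N, a m * (m : ℂ) ^ (-(1 + (t : ℂ) * I)) =
      ∑ n ∈ Finset.Icc 1 N, b n * (n : ℂ) ^ (-((t : ℂ) * I)) := by
    intro t
    rw [show Finset.Icc ⌈X⌉₊ N = (Finset.Icc 1 N).filter (fun n => ⌈X⌉₊ ≤ n) by
      ext n; simp only [Finset.mem_Icc, Finset.mem_filter]; omega]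
    rw [Finset.sum_filter]
    refine Finset.sum_congr rfl fun n hn => ?_
    rw [Finset.mem_Icc] at hn
    have hn0 : (n : ℂ) ≠ 0 := Nat.cast_ne_zero.2 (by omega)
    simp only [hb]
    split_ifs with h
    · rw [neg_add, Complex.cpow_add _ _ hn0, Complex.cpow_neg_one]; ring
    · simp
  -- the coefficients
  have hb_le : ∀ n, ‖b n‖ ≤ 1 / X := by
    intro n
    simp only [hb]
    split_ifs with h
    · have hn1 : (1 : ℝ) ≤ n := by exact_mod_cast hceil.trans h
      have hXn : X ≤ n := (Nat.le_ceil X).trans (by exact_mod_cast h)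
      rw [norm_mul, norm_inv, Complex.norm_natCast]
      calc ‖a n‖ * (n : ℝ)⁻¹ ≤ 1 * (n : ℝ)⁻¹ := by gcongr; exact ha n
        _ = 1 / n := by ring
        _ ≤ 1 / X := one_div_le_one_div_of_le hX0 hXn
    · rw [norm_zero]; positivity
  have hNle : (N : ℝ) ≤ 4 * X := Nat.floor_le (by linarith)
  have hsumb : ∑ n ∈ Finset.Icc 1 N, ‖b n‖ ^ 2 ≤ 4 / X := by
    calc ∑ n ∈ Finset.Icc 1 N, ‖b n‖ ^ 2 ≤ ∑ n ∈ Finset.Icc 1 N, (1 / X) ^ 2 :=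
          Finset.sum_le_sum fun n _ => pow_le_pow_left₀ (norm_nonneg _) (hb_le n) 2
      _ = N * (1 / X) ^ 2 := by simp
      _ ≤ 4 * X * (1 / X) ^ 2 := by gcongr
      _ = 4 / X := by field_simp
  -- the mean value theorem on `[-2T, 2T]`
  have hmvt := Literature.NumberTheory.LFunctions.dirichletPolynomial_meanSquare_le b N
    (T := 2 * T) (by linarith)
  have hcont := continuous_Nsq a hX0
  calc ∫ t in T..2 * T, Nsq a X t ≤ ∫ t in -(2 * T)..2 * T, Nsq a X t := by
        refine intervalIntegral.integral_mono_interval (by linarith) (by linarith) le_rfl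
          (Eventually.of_forall fun t => Nsq_nonneg a X t) (hcont.intervalIntegrable _ _)
    _ = ∫ t in -(2 * T)..2 * T, ‖∑ n ∈ Finset.Icc 1 N, b n * (n : ℂ) ^ (-((t : ℂ) * I))‖ ^ 2 := by
        refine intervalIntegral.integral_congr fun t _ => ?_
        simp only [Nsq]
        rw [hid t]
    _ ≤ (5 * (2 * T) + 18 * N) * ∑ n ∈ Finset.Icc 1 N, ‖b n‖ ^ 2 := hmvt
    _ ≤ (10 * T + 72 * X) * (4 / X) := by
        apply mul_le_mul _ hsumb (Finset.sum_nonneg fun n _ => sq_nonneg _) (by positivity)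
        linarith

/-- The `max` term is bounded by any common nonnegative bound of its members (in particular it
carries no junk value: `Real.iSup_le`). [folklore] -/
theorem Smax_le {a : ℕ → ℂ} {X h₁ M : ℝ} (hM : 0 ≤ M)
    (h : ∀ T : ℝ, X / h₁ ≤ T → (X / h₁) / T * ∫ t in T..2 * T, Nsq a X t ≤ M) :
    Smax a X h₁ ≤ M :=
  Real.iSup_le (fun T => h T T.2) hM

/-- The `max` term is nonnegative (`X/h₁ > 0`). [folklore] -/
theorem Smax_nonneg (a : ℕ → ℂ) {X h₁ : ℝ} (hXh : 0 < X / h₁) : 0 ≤ Smax a X h₁ := by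
  refine Real.iSup_nonneg fun T => ?_
  have hT : 0 < (T : ℝ) := hXh.trans_le T.2
  exact mul_nonneg (by positivity)
    (intervalIntegral.integral_nonneg (by linarith) fun t _ => Nsq_nonneg a X t)

/-- The two elementary terms of `Nsq_aSeq_le`, bounded on `0 ≤ t ≤ 400λ` (`L = 20λ`,
`X ≥ λ^{10}`, `K = B₁ + B₂ + 1`). [folklore] -/
theorem base_le_near {B₁ B₂ lam X K t : ℝ} (hB₁0 : 0 ≤ B₁) (hB₂0 : 0 ≤ B₂) (hlam : 1 ≤ lam)
    (hX : lam ^ 10 ≤ X) (hK : K = B₁ + B₂ + 1) (ht : 0 ≤ t) (htT : t ≤ 400 * lam) :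
    12 * B₂ / (t + 20 * lam) ^ 2 + 3 * (B₁ + 1 + (t + 20 * lam)) / (2 * X) ≤ 633 * K / lam ^ 2 := by
  have hlam0 : 0 < lam := by linarith
  have hl2 : 0 < lam ^ 2 := by positivity
  have hX0 : 0 < X := lt_of_lt_of_le (by positivity) hX
  have hK1 : 1 ≤ K := by rw [hK]; linarith
  have h3 : lam ^ 3 ≤ lam ^ 10 := pow_le_pow_right₀ hlam (by norm_num)
  have m1 : lam / X ≤ 1 / lam ^ 2 := by
    rw [div_le_div_iff₀ hX0 hl2]; nlinarith
  have ha : 12 * B₂ / (t + 20 * lam) ^ 2 ≤ K / lam ^ 2 := by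
    have h1 : 400 * lam ^ 2 ≤ (t + 20 * lam) ^ 2 := by nlinarith
    calc 12 * B₂ / (t + 20 * lam) ^ 2 ≤ 12 * B₂ / (400 * lam ^ 2) :=
          div_le_div_of_nonneg_left (by positivity) (by positivity) h1
      _ ≤ K / lam ^ 2 := by
          rw [div_le_div_iff₀ (by positivity) hl2, hK]; nlinarith
  have hb : 3 * (B₁ + 1 + (t + 20 * lam)) / (2 * X) ≤ 632 * K / lam ^ 2 := by
    have h1 : B₁ + 1 + (t + 20 * lam) ≤ 421 * K * lam := by rw [hK]; nlinarith
    calc 3 * (B₁ + 1 + (t + 20 * lam)) / (2 * X) ≤ 3 * (421 * K * lam) / (2 * X) := by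
          gcongr
      _ = (1263 / 2) * K * (lam / X) := by ring
      _ ≤ (1263 / 2) * K * (1 / lam ^ 2) := by gcongr
      _ ≤ 632 * K / lam ^ 2 := by
          rw [mul_one_div, div_le_div_iff_of_pos_right hl2]; nlinarith
  exact (add_le_add ha hb).trans_eq (by ring)

/-- The same two terms on `0 ≤ t ≤ 2λ⁵`. [folklore] -/
theorem base_le_far {B₁ B₂ lam X K t : ℝ} (hB₁0 : 0 ≤ B₁) (hB₂0 : 0 ≤ B₂) (hlam : 1 ≤ lam)
    (hX : lam ^ 10 ≤ X) (hK : K = B₁ + B₂ + 1) (ht : 0 ≤ t) (ht5 : t ≤ 2 * lam ^ 5) :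
    12 * B₂ / (t + 20 * lam) ^ 2 + 3 * (B₁ + 1 + (t + 20 * lam)) / (2 * X) ≤ 36 * K / lam ^ 2 := by
  have hlam0 : 0 < lam := by linarith
  have hl2 : 0 < lam ^ 2 := by positivity
  have hX0 : 0 < X := lt_of_lt_of_le (by positivity) hX
  have hK1 : 1 ≤ K := by rw [hK]; linarith
  have hK0 : 0 ≤ K := by linarith
  have h3 : lam ^ 3 ≤ lam ^ 10 := pow_le_pow_right₀ hlam (by norm_num)
  have h7 : lam ^ 7 ≤ lam ^ 10 := pow_le_pow_right₀ hlam (by norm_num)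
  have h2 : lam ^ 2 ≤ lam ^ 10 := pow_le_pow_right₀ hlam (by norm_num)
  have m1 : lam / X ≤ 1 / lam ^ 2 := by
    rw [div_le_div_iff₀ hX0 hl2]; nlinarith
  have m2 : K / X ≤ K / lam ^ 2 := div_le_div_of_nonneg_left hK0 hl2 (h2.trans hX)
  have m3 : lam ^ 5 / X ≤ 1 / lam ^ 2 := by
    rw [div_le_div_iff₀ hX0 hl2]; nlinarith
  have ha : 12 * B₂ / (t + 20 * lam) ^ 2 ≤ K / lam ^ 2 := by
    have h1 : 400 * lam ^ 2 ≤ (t + 20 * lam) ^ 2 := by nlinarith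
    calc 12 * B₂ / (t + 20 * lam) ^ 2 ≤ 12 * B₂ / (400 * lam ^ 2) :=
          div_le_div_of_nonneg_left (by positivity) (by positivity) h1
      _ ≤ K / lam ^ 2 := by
          rw [div_le_div_iff₀ (by positivity) hl2, hK]; nlinarith
  have hc : 3 * (B₁ + 1 + (t + 20 * lam)) / (2 * X) ≤ 35 * K / lam ^ 2 := by
    have h1 : B₁ + 1 + (t + 20 * lam) ≤ K + 2 * lam ^ 5 + 20 * lam := by rw [hK]; linarith
    calc 3 * (B₁ + 1 + (t + 20 * lam)) / (2 * X)
        ≤ 3 * (K + 2 * lam ^ 5 + 20 * lam) / (2 * X) := by gcongr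
      _ = (3 / 2) * (K / X + 2 * (lam ^ 5 / X) + 20 * (lam / X)) := by ring
      _ ≤ (3 / 2) * (K / lam ^ 2 + 2 * (1 / lam ^ 2) + 20 * (1 / lam ^ 2)) := by gcongr
      _ = (3 / 2) * (K + 22) / lam ^ 2 := by ring
      _ ≤ 35 * K / lam ^ 2 := by
          rw [div_le_div_iff_of_pos_right hl2]; nlinarith
  exact (add_le_add ha hc).trans_eq (by ring)

/-- The integrand on `0 ≤ t ≤ 400λ`: `N(X, t) ≤ 400689 K²/λ²`. [folklore] -/
theorem Nsq_aSeq_le_near {B₁ B₂ : ℝ} (hB₁0 : 0 ≤ B₁) (hB₂0 : 0 ≤ B₂)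
    (hB₁ : ∀ u, |deriv g u| ≤ B₁) (hB₂ : ∀ u, |deriv (deriv g) u| ≤ B₂) {lam X K t : ℝ}
    (hlam : 1 ≤ lam) (hX : lam ^ 10 ≤ X) (hK : K = B₁ + B₂ + 1) (ht : 0 ≤ t)
    (htT : t ≤ 400 * lam) : Nsq (aSeq X (20 * lam)) X t ≤ 400689 * K ^ 2 / lam ^ 2 := by
  have hlam0 : 0 < lam := by linarith
  have hX1 : 1 ≤ X := le_trans (one_le_pow₀ hlam) hX
  have hX0 : 0 < X := by linarith
  have hbase := base_le_near hB₁0 hB₂0 hlam hX hK ht htT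
  have hbase0 : 0 ≤ 12 * B₂ / (t + 20 * lam) ^ 2 + 3 * (B₁ + 1 + (t + 20 * lam)) / (2 * X) := by
    positivity
  have m5 : 1 / lam ^ 4 ≤ 1 / lam ^ 2 :=
    div_le_div_of_nonneg_left zero_le_one (by positivity) (pow_le_pow_right₀ hlam (by norm_num))
  have hsq : (633 * K / lam ^ 2) ^ 2 ≤ 400689 * K ^ 2 / lam ^ 2 := by
    calc (633 * K / lam ^ 2) ^ 2 = 400689 * K ^ 2 * (1 / lam ^ 4) := by field_simp; ring
      _ ≤ 400689 * K ^ 2 * (1 / lam ^ 2) := mul_le_mul_of_nonneg_left m5 (by positivity)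
      _ = 400689 * K ^ 2 / lam ^ 2 := mul_one_div _ _
  have h := Nsq_aSeq_le hB₁ hB₂ hX1 (L := 20 * lam) (t := t) (by positivity) ht
  exact h.trans ((pow_le_pow_left₀ hbase0 hbase 2).trans hsq)

/-- The integrand on `400λ ≤ t ≤ 2λ⁵`: `N(X, t) ≤ 1296 K²/λ⁴`. [folklore] -/
theorem Nsq_aSeq_le_far {B₁ B₂ : ℝ} (hB₁0 : 0 ≤ B₁) (hB₂0 : 0 ≤ B₂)
    (hB₁ : ∀ u, |deriv g u| ≤ B₁) (hB₂ : ∀ u, |deriv (deriv g) u| ≤ B₂) {lam X K t : ℝ}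
    (hlam : 1 ≤ lam) (hX : lam ^ 10 ≤ X) (hK : K = B₁ + B₂ + 1) (htT : 400 * lam ≤ t)
    (ht5 : t ≤ 2 * lam ^ 5) : Nsq (aSeq X (20 * lam)) X t ≤ 1296 * K ^ 2 / lam ^ 4 := by
  have hlam0 : 0 < lam := by linarith
  have hX1 : 1 ≤ X := le_trans (one_le_pow₀ hlam) hX
  have hX0 : 0 < X := by linarith
  have ht : 0 ≤ t := le_trans (by positivity) htT
  have hbase := base_le_far hB₁0 hB₂0 hlam hX hK ht ht5
  have hbase0 : 0 ≤ 12 * B₂ / (t + 20 * lam) ^ 2 + 3 * (B₁ + 1 + (t + 20 * lam)) / (2 * X) := by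
    positivity
  have hsq : (36 * K / lam ^ 2) ^ 2 = 1296 * K ^ 2 / lam ^ 4 := by field_simp; ring
  have h := Nsq_aSeq_le hB₁ hB₂ hX1 (L := 20 * lam) (t := t) (by positivity) ht
  exact h.trans ((pow_le_pow_left₀ hbase0 hbase 2).trans_eq hsq)

/-- The `max` term for the test sequence: `≤ 649600 K²/λ²` (pointwise bound for `T ≤ λ⁵`,
mean value theorem for `T ≥ λ⁵`). [folklore] -/
theorem Smax_aSeq_le {B₁ B₂ : ℝ} (hB₁0 : 0 ≤ B₁) (hB₂0 : 0 ≤ B₂)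
    (hB₁ : ∀ u, |deriv g u| ≤ B₁) (hB₂ : ∀ u, |deriv (deriv g) u| ≤ B₂) {lam X K h₁ : ℝ}
    (hlam : 1 ≤ lam) (hX : lam ^ 10 ≤ X) (hK : K = B₁ + B₂ + 1) (hXh₁ : X / h₁ = 400 * lam) :
    Smax (aSeq X (20 * lam)) X h₁ ≤ 649600 * K ^ 2 / lam ^ 2 := by
  have hlam0 : 0 < lam := by linarith
  have hl2 : 0 < lam ^ 2 := by positivity
  have hX1 : 1 ≤ X := le_trans (one_le_pow₀ hlam) hX
  have hX0 : 0 < X := by linarith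
  have hK1 : 1 ≤ K := by rw [hK]; linarith
  have hK2 : 1 ≤ K ^ 2 := one_le_pow₀ hK1
  have h3 : lam ^ 3 ≤ lam ^ 10 := pow_le_pow_right₀ hlam (by norm_num)
  have m1 : lam / X ≤ 1 / lam ^ 2 := by
    rw [div_le_div_iff₀ hX0 hl2]; nlinarith
  have m4 : lam / lam ^ 5 ≤ 1 / lam ^ 2 := by
    rw [div_le_div_iff₀ (by positivity) hl2]
    have : lam ^ 3 ≤ lam ^ 5 := pow_le_pow_right₀ hlam (by norm_num)
    nlinarith
  have m6 : 1 / lam ^ 3 ≤ 1 / lam ^ 2 :=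
    div_le_div_of_nonneg_left zero_le_one hl2 (pow_le_pow_right₀ hlam (by norm_num))
  refine Smax_le (by positivity) fun T hT => ?_
  rw [hXh₁] at hT ⊢
  have hT0 : 0 < T := lt_of_lt_of_le (by positivity) hT
  have hT2 : T ≤ 2 * T := by linarith
  have hcoef : 0 ≤ 400 * lam / T := by positivity
  rcases le_or_gt T (lam ^ 5) with h5 | h5
  · -- `T ≤ λ⁵`: pointwise bound
    have harith : 400 * lam / T * (1296 * K ^ 2 / lam ^ 4 * T) ≤ 649600 * K ^ 2 / lam ^ 2 := by
      calc 400 * lam / T * (1296 * K ^ 2 / lam ^ 4 * T) = 518400 * K ^ 2 * (1 / lam ^ 3) := by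
            field_simp; ring
        _ ≤ 518400 * K ^ 2 * (1 / lam ^ 2) := mul_le_mul_of_nonneg_left m6 (by positivity)
        _ ≤ 649600 * K ^ 2 * (1 / lam ^ 2) :=
            mul_le_mul_of_nonneg_right (by nlinarith) (by positivity)
        _ = 649600 * K ^ 2 / lam ^ 2 := mul_one_div _ _
    have hI : ∫ t in T..2 * T, Nsq (aSeq X (20 * lam)) X t ≤ 1296 * K ^ 2 / lam ^ 4 * T := by
      have hint : ‖∫ t in T..2 * T, Nsq (aSeq X (20 * lam)) X t‖ ≤
          1296 * K ^ 2 / lam ^ 4 * |2 * T - T| := by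
        refine intervalIntegral.norm_integral_le_of_norm_le_const fun t ht => ?_
        rw [Set.uIoc_of_le hT2] at ht
        rw [Real.norm_eq_abs, abs_of_nonneg (Nsq_nonneg _ _ _)]
        exact Nsq_aSeq_le_far hB₁0 hB₂0 hB₁ hB₂ hlam hX hK (hT.trans ht.1.le)
          (by linarith [ht.2, h5])
      rw [show |2 * T - T| = T by rw [two_mul, add_sub_cancel_right, abs_of_pos hT0]] at hint
      exact (Real.le_norm_self _).trans hint
    exact (mul_le_mul_of_nonneg_left hI hcoef).trans harith
  · -- `T ≥ λ⁵`: mean value theorem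
    have hlamT : lam / T ≤ 1 / lam ^ 2 := by
      calc lam / T ≤ lam / lam ^ 5 := div_le_div_of_nonneg_left hlam0.le (by positivity) h5.le
        _ ≤ 1 / lam ^ 2 := m4
    have harith : 400 * lam / T * ((10 * T + 72 * X) * (4 / X)) ≤ 649600 * K ^ 2 / lam ^ 2 := by
      calc 400 * lam / T * ((10 * T + 72 * X) * (4 / X))
          = 16000 * (lam / X) + 115200 * (lam / T) := by field_simp; ring
        _ ≤ 16000 * (1 / lam ^ 2) + 115200 * (1 / lam ^ 2) :=
            add_le_add (mul_le_mul_of_nonneg_left m1 (by norm_num))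
              (mul_le_mul_of_nonneg_left hlamT (by norm_num))
        _ = 131200 * (1 / lam ^ 2) := by ring
        _ ≤ 649600 * K ^ 2 * (1 / lam ^ 2) :=
            mul_le_mul_of_nonneg_right (by nlinarith) (by positivity)
        _ = 649600 * K ^ 2 / lam ^ 2 := mul_one_div _ _
    have hmvt := integral_Nsq_le_mvt (aSeq X (20 * lam)) (norm_aSeq_le X (20 * lam)) hX1 hT0
    exact (mul_le_mul_of_nonneg_left hmvt hcoef).trans harith

/-- **The right-hand side of Lemma 14 is small for the test sequence.**  With `L = 20λ`,
`h₁ = X/(400λ)` (so `X/h₁ = 400λ`), `λ ≥ 1`, `X ≥ λ^{10}` and any `0 ≤ T₀ ≤ 400λ`: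
`∫_{T₀}^{X/h₁} (N(X,t) + max-term) dt ≤ 10⁹ (B₁ + B₂ + 1)² / λ`. [folklore] -/
theorem rhs_integral_le {B₁ B₂ : ℝ} (hB₁0 : 0 ≤ B₁) (hB₂0 : 0 ≤ B₂) (hB₁ : ∀ u, |deriv g u| ≤ B₁)
    (hB₂ : ∀ u, |deriv (deriv g) u| ≤ B₂) {lam X T₀ h₁ : ℝ} (hlam : 1 ≤ lam)
    (hX : lam ^ 10 ≤ X) (hT₀ : 0 ≤ T₀) (hT₀' : T₀ ≤ 400 * lam) (hXh₁ : X / h₁ = 400 * lam) :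
    ∫ t in T₀..X / h₁, (Nsq (aSeq X (20 * lam)) X t + Smax (aSeq X (20 * lam)) X h₁) ≤
      10 ^ 9 * (B₁ + B₂ + 1) ^ 2 / lam := by
  have hlam0 : 0 < lam := by linarith
  have hl2 : 0 < lam ^ 2 := by positivity
  obtain ⟨K, hK⟩ : ∃ K : ℝ, K = B₁ + B₂ + 1 := ⟨_, rfl⟩
  have hK1 : 1 ≤ K := by rw [hK]; linarith
  rw [← hK, hXh₁]
  have hS := Smax_aSeq_le hB₁0 hB₂0 hB₁ hB₂ hlam hX hK hXh₁
  have hS0 : 0 ≤ Smax (aSeq X (20 * lam)) X h₁ := Smax_nonneg _ (by rw [hXh₁]; positivity)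
  have habs : |400 * lam - T₀| ≤ 400 * lam := by
    rw [abs_of_nonneg (sub_nonneg.2 hT₀')]; exact sub_le_self _ hT₀
  have hC0 : 0 ≤ 1050289 * K ^ 2 / lam ^ 2 := by positivity
  have harith : 1050289 * K ^ 2 / lam ^ 2 * (400 * lam) ≤ 10 ^ 9 * K ^ 2 / lam := by
    have e : 1050289 * K ^ 2 / lam ^ 2 * (400 * lam) = 420115600 * K ^ 2 / lam := by
      field_simp; ring
    rw [e]
    exact div_le_div_of_nonneg_right (by nlinarith) hlam0.le
  have hI : ∫ t in T₀..400 * lam, (Nsq (aSeq X (20 * lam)) X t + Smax (aSeq X (20 * lam)) X h₁)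
      ≤ 1050289 * K ^ 2 / lam ^ 2 * (400 * lam) := by
    have hint : ‖∫ t in T₀..400 * lam,
        (Nsq (aSeq X (20 * lam)) X t + Smax (aSeq X (20 * lam)) X h₁)‖
          ≤ 1050289 * K ^ 2 / lam ^ 2 * |400 * lam - T₀| := by
      refine intervalIntegral.norm_integral_le_of_norm_le_const fun t ht => ?_
      rw [Set.uIoc_of_le hT₀'] at ht
      have ht0 : 0 ≤ t := hT₀.trans ht.1.le
      rw [Real.norm_eq_abs, abs_of_nonneg (add_nonneg (Nsq_nonneg _ _ _) hS0)]
      exact (add_le_add (Nsq_aSeq_le_near hB₁0 hB₂0 hB₁ hB₂ hlam hX hK ht0 ht.2) hS).trans_eq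
        (by ring)
    exact ((Real.le_norm_self _).trans hint).trans (mul_le_mul_of_nonneg_left habs hC0)
  exact hI.trans harith

/-! ### The left-hand side: short sums of `m^{-iL}` -/

/-- `E(θ) = ∫_0^1 e^{-iθs} ds` (`= (1 - e^{-iθ})/(iθ)` for `θ ≠ 0`). [folklore] -/
def E (θ : ℝ) : ℂ := ∫ s in (0 : ℝ)..1, cexp (-(θ : ℂ) * I * s)

/-- `|e^{-iθs}| = 1`. [folklore] -/
theorem norm_cexp_neg_mul_I_mul (θ s : ℝ) : ‖cexp (-(θ : ℂ) * I * s)‖ = 1 := by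
  rw [show -(θ : ℂ) * I * s = ((-(θ * s) : ℝ) : ℂ) * I by push_cast; ring]
  exact Complex.norm_exp_ofReal_mul_I _

/-- `‖e^{ia} - e^{ib}‖ ≤ |a - b|` for real `a, b`. [folklore] -/
theorem norm_cexp_mul_I_sub_cexp_mul_I_le (a b : ℝ) :
    ‖cexp ((a : ℂ) * I) - cexp ((b : ℂ) * I)‖ ≤ |a - b| := by
  have h : cexp ((a : ℂ) * I) - cexp ((b : ℂ) * I) =
      cexp ((b : ℂ) * I) * (cexp (I * ((a - b : ℝ) : ℂ)) - 1) := by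
    rw [mul_sub, mul_one, ← Complex.exp_add]
    congr 2; push_cast; ring
  rw [h, norm_mul, Complex.norm_exp_ofReal_mul_I, one_mul]
  have := Real.norm_exp_I_mul_ofReal_sub_one_le (x := a - b)
  rwa [Real.norm_eq_abs] at this

/-- `‖E(θ) - 1‖ ≤ θ` for `θ ≥ 0`. [folklore] -/
theorem norm_E_sub_one_le {θ : ℝ} (hθ : 0 ≤ θ) : ‖E θ - 1‖ ≤ θ := by
  have hcont : Continuous fun s : ℝ => cexp (-(θ : ℂ) * I * s) := by fun_prop
  have h1 : E θ - 1 = ∫ s in (0 : ℝ)..1, (cexp (-(θ : ℂ) * I * s) - 1) := by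
    rw [intervalIntegral.integral_sub (hcont.intervalIntegrable _ _) intervalIntegrable_const,
      intervalIntegral.integral_const]
    simp [E]
  rw [h1]
  have h2 := intervalIntegral.norm_integral_le_of_norm_le_const (a := (0 : ℝ)) (b := 1) (C := θ)
    (f := fun s : ℝ => cexp (-(θ : ℂ) * I * s) - 1) (fun s hs => by
      rw [Set.uIoc_of_le zero_le_one] at hs
      have e : cexp (-(θ : ℂ) * I * s) = cexp (((-(θ * s) : ℝ) : ℂ) * I) := by
        push_cast; ring_nf
      have e0 : (1 : ℂ) = cexp (((0 : ℝ) : ℂ) * I) := by simp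
      rw [e, e0]
      refine (norm_cexp_mul_I_sub_cexp_mul_I_le _ _).trans ?_
      rw [sub_zero, abs_neg, abs_of_nonneg (by nlinarith [hs.1])]
      nlinarith [hs.2])
  simpa using h2

/-- `‖E(θ)‖ ≥ 1 - θ` for `θ ≥ 0`. [folklore] -/
theorem one_sub_le_norm_E {θ : ℝ} (hθ : 0 ≤ θ) : 1 - θ ≤ ‖E θ‖ := by
  have h := norm_sub_norm_le (1 : ℂ) (E θ)
  rw [norm_one, norm_sub_rev] at h
  linarith [norm_E_sub_one_le hθ]

/-- `‖E(θ)‖ ≤ 2/θ` for `θ > 0` (closed form). [folklore] -/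
theorem norm_E_le {θ : ℝ} (hθ : 0 < θ) : ‖E θ‖ ≤ 2 / θ := by
  have hc : (-(θ : ℂ) * I) ≠ 0 := by
    intro h; have := congrArg Complex.im h; simp [hθ.ne'] at this
  unfold E
  rw [integral_exp_mul_complex hc, norm_div]
  have hn : ‖-(θ : ℂ) * I‖ = θ := by simp [abs_of_pos hθ]
  rw [hn, div_le_div_iff_of_pos_right hθ]
  calc ‖cexp (-(θ : ℂ) * I * (1 : ℝ)) - cexp (-(θ : ℂ) * I * (0 : ℝ))‖
      ≤ ‖cexp (-(θ : ℂ) * I * (1 : ℝ))‖ + ‖cexp (-(θ : ℂ) * I * (0 : ℝ))‖ := norm_sub_le _ _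
    _ = 2 := by rw [norm_cexp_neg_mul_I_mul, norm_cexp_neg_mul_I_mul]; norm_num

/-- For `u ≥ 0`: `‖(1 + u)^{-iL} - e^{-iLu}‖ ≤ L u²` (`L ≥ 0`). [folklore] -/
theorem norm_one_add_cpow_sub_cexp_le {u L : ℝ} (hu : 0 ≤ u) (hL : 0 ≤ L) :
    ‖((1 + u : ℝ) : ℂ) ^ (-((L : ℂ) * I)) - cexp (-(L : ℂ) * I * u)‖ ≤ L * u ^ 2 := by
  have hpos : 0 < 1 + u := by linarith
  have hne : ((1 + u : ℝ) : ℂ) ≠ 0 := ofReal_ne_zero.2 hpos.ne'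
  have e1 : ((1 + u : ℝ) : ℂ) ^ (-((L : ℂ) * I)) = cexp (((-(L * Real.log (1 + u))) : ℝ) * I) := by
    rw [Complex.cpow_def_of_ne_zero hne, ← Complex.ofReal_log hpos.le]
    congr 1; push_cast; ring
  have e2 : cexp (-(L : ℂ) * I * u) = cexp (((-(L * u)) : ℝ) * I) := by
    congr 1; push_cast; ring
  rw [e1, e2]
  refine (norm_cexp_mul_I_sub_cexp_mul_I_le _ _).trans ?_
  rw [show -(L * Real.log (1 + u)) - -(L * u) = -(L * (Real.log (1 + u) - u)) by ring, abs_neg,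
    abs_mul, abs_of_nonneg hL]
  exact mul_le_mul_of_nonneg_left
    (Literature.NumberTheory.LFunctions.LogEulerProduct.abs_log_one_add_sub_le_sq hu) hL

/-- **Main term**: for `0 < x`, `0 ≤ h ≤ x`, `L ≥ 0`,
`‖∫_x^{x+h} y^{-iL} dy - x^{-iL} · h E(Lh/x)‖ ≤ L h³ / x²`. [folklore] -/
theorem norm_integral_cpow_sub_main_le {x h L : ℝ} (hx : 0 < x) (hh : 0 ≤ h) (hL : 0 ≤ L) :
    ‖(∫ y in x..x + h, (y : ℂ) ^ (-((L : ℂ) * I)))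
        - (x : ℂ) ^ (-((L : ℂ) * I)) * (h * E (L * h / x))‖ ≤ L * h ^ 3 / x ^ 2 := by
  set c : ℂ := -((L : ℂ) * I) with hc
  -- shift to `[0, h]`
  have hshift : ∫ y in x..x + h, (y : ℂ) ^ c = ∫ w in (0 : ℝ)..h, ((x + w : ℝ) : ℂ) ^ c := by
    have := intervalIntegral.integral_comp_add_left (fun y : ℝ => (y : ℂ) ^ c) x (a := 0) (b := h)
    simpa using this.symm
  -- the main term as an integral over `[0, h]`
  set f : ℝ → ℂ := fun w => cexp (-(L : ℂ) * I * (w / x)) with hf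
  have hmain : (x : ℂ) ^ c * (h * E (L * h / x)) = ∫ w in (0 : ℝ)..h, (x : ℂ) ^ c * f w := by
    rw [intervalIntegral.integral_const_mul]
    congr 1
    have hsub := intervalIntegral.smul_integral_comp_mul_left (f := f) (a := 0) (b := 1) h
    rw [mul_zero, mul_one] at hsub
    rw [← hsub, Complex.real_smul]
    congr 1
    unfold E
    refine intervalIntegral.integral_congr fun s _ => ?_
    simp only [hf]
    congr 1; push_cast; field_simp
  -- pointwise bound on `[0, h]`
  have hpt : ∀ w ∈ Set.uIoc (0 : ℝ) h,
      ‖((x + w : ℝ) : ℂ) ^ c - (x : ℂ) ^ c * f w‖ ≤ L * h ^ 2 / x ^ 2 := by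
    intro w hw
    rw [Set.uIoc_of_le hh] at hw
    have hw0 : 0 ≤ w := hw.1.le
    have hfac : ((x + w : ℝ) : ℂ) ^ c = (x : ℂ) ^ c * ((1 + w / x : ℝ) : ℂ) ^ c := by
      rw [show x + w = x * (1 + w / x) by field_simp, Complex.ofReal_mul,
        Complex.mul_cpow_ofReal_nonneg hx.le (by positivity)]
    rw [hfac, ← mul_sub, norm_mul, Complex.norm_cpow_eq_rpow_re_of_pos hx]
    have hcre : c.re = 0 := by simp [hc]
    rw [hcre, Real.rpow_zero, one_mul]
    have h1 := norm_one_add_cpow_sub_cexp_le (u := w / x) (L := L) (by positivity) hL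
    have e : cexp (-(L : ℂ) * I * ((w / x : ℝ) : ℂ)) = f w := by simp only [hf]; push_cast; ring_nf
    rw [e] at h1
    refine h1.trans ?_
    rw [div_pow, ← mul_div_assoc]
    gcongr
    exact hw.2
  -- continuity, for integrability
  have hcont1 : ContinuousOn (fun w : ℝ => ((x + w : ℝ) : ℂ) ^ c) (Set.uIcc 0 h) := by
    have : ContinuousOn (fun w : ℝ => ((fun y : ℝ => (y : ℂ) ^ c) ∘ fun w => x + w) w)
        (Set.uIcc 0 h) := by
      refine (continuousOn_ofReal_cpow c (s := Set.Ici x) fun y hy => hx.trans_le hy).comp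
        (continuous_const.add continuous_id).continuousOn fun w hw => ?_
      rw [Set.uIcc_of_le hh] at hw
      exact Set.mem_Ici.2 (by linarith [hw.1])
    simpa using this
  have hcont2 : Continuous fun w : ℝ => (x : ℂ) ^ c * f w := by simp only [hf]; fun_prop
  rw [hshift, hmain, ← intervalIntegral.integral_sub hcont1.intervalIntegrable
    (hcont2.intervalIntegrable _ _)]
  refine (intervalIntegral.norm_integral_le_of_norm_le_const hpt).trans ?_
  rw [sub_zero, abs_of_nonneg hh]
  exact le_of_eq (by ring)

/-- **Short sums of `m^{-iL}` versus the integral** (`x > 0`, `h ≥ 0`, `L > 0`):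
`‖∑_{x ≤ m ≤ x+h} m^{-iL} - ∫_x^{x+h} y^{-iL} dy‖ ≤ Lh/(2x) + 2` (Euler–Maclaurin with
`|d/dy y^{-iL}| = L/y ≤ L/x`, boundary terms of modulus `1`, and at most one extra term `m = x`).
[folklore] -/
theorem norm_sum_cpow_sub_integral_le {x h L : ℝ} (hx : 0 < x) (hh : 0 ≤ h) (hL : 0 < L) :
    ‖∑ m ∈ Finset.Icc ⌈x⌉₊ ⌊x + h⌋₊, (m : ℂ) ^ (-((L : ℂ) * I))
        - ∫ y in x..x + h, (y : ℂ) ^ (-((L : ℂ) * I))‖ ≤ L * h / (2 * x) + 2 := by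
  have hc0 : (-((L : ℂ) * I)) ≠ 0 := by
    intro h0; have := congrArg Complex.im h0; simp [hL.ne'] at this
  have hcre : (-((L : ℂ) * I)).re = 0 := by simp
  have hc1re : (-((L : ℂ) * I) - 1).re = -1 := by simp
  have hnc : ‖-((L : ℂ) * I)‖ = L := by simp [abs_of_pos hL]
  set c : ℂ := -((L : ℂ) * I) with hc
  set φ : ℝ → ℂ := fun y => (y : ℂ) ^ c with hφ
  have hnorm1 : ∀ y : ℝ, 0 < y → ‖φ y‖ = 1 := fun y hy => by
    simp only [hφ]; rw [Complex.norm_cpow_eq_rpow_re_of_pos hy, hcre, Real.rpow_zero]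
  -- Euler–Maclaurin
  have hxh : x ≤ x + h := by linarith
  have hderiv : ∀ y ∈ Icc x (x + h), HasDerivAt φ (c * (y : ℂ) ^ (c - 1)) y :=
    fun y hy => hasDerivAt_ofReal_cpow (hx.trans_le hy.1) hc0
  have hcont : ContinuousOn (fun y : ℝ => c * (y : ℂ) ^ (c - 1)) (Icc x (x + h)) :=
    continuousOn_const.mul (continuousOn_ofReal_cpow _ fun y hy => hx.trans_le hy.1)
  have hM : ∀ y ∈ Icc x (x + h), ‖c * (y : ℂ) ^ (c - 1)‖ ≤ L / x := by
    intro y hy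
    have hy0 : 0 < y := hx.trans_le hy.1
    rw [norm_mul, hnc, Complex.norm_cpow_eq_rpow_re_of_pos hy0, hc1re, Real.rpow_neg_one]
    exact mul_le_mul_of_nonneg_left (inv_anti₀ hx hy.1) hL.le
  have hEM := norm_sum_Ioc_sub_integral_le hx.le hxh hderiv hcont hM
  rw [hnorm1 x hx, hnorm1 (x + h) (by linarith)] at hEM
  -- the extra term
  have hextra := norm_sum_Icc_ceil_sub_sum_Ioc_floor_le x ⌊x + h⌋₊ (fun n => φ n)
  have hφfloor : ‖φ (⌊x⌋₊ : ℕ)‖ ≤ 1 := by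
    rcases Nat.eq_zero_or_pos ⌊x⌋₊ with h0 | hpos
    · rw [h0]; simp only [hφ, Nat.cast_zero, Complex.ofReal_zero]
      rw [Complex.zero_cpow hc0, norm_zero]
      exact zero_le_one
    · exact (hnorm1 _ (by exact_mod_cast hpos)).le
  -- casts `ℕ → ℝ → ℂ` versus `ℕ → ℂ`
  have hcast : ∀ s : Finset ℕ, ∑ m ∈ s, (m : ℂ) ^ c = ∑ m ∈ s, φ m := fun s =>
    Finset.sum_congr rfl fun m _ => by simp only [hφ, Complex.ofReal_natCast]
  rw [hcast]
  calc ‖∑ m ∈ Finset.Icc ⌈x⌉₊ ⌊x + h⌋₊, φ m - ∫ y in x..x + h, φ y‖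
      = ‖(∑ m ∈ Finset.Icc ⌈x⌉₊ ⌊x + h⌋₊, φ m - ∑ m ∈ Finset.Ioc ⌊x⌋₊ ⌊x + h⌋₊, φ m)
          + (∑ m ∈ Finset.Ioc ⌊x⌋₊ ⌊x + h⌋₊, φ m - ∫ y in x..x + h, φ y)‖ := by
        rw [sub_add_sub_cancel]
    _ ≤ ‖∑ m ∈ Finset.Icc ⌈x⌉₊ ⌊x + h⌋₊, φ m - ∑ m ∈ Finset.Ioc ⌊x⌋₊ ⌊x + h⌋₊, φ m‖
          + ‖∑ m ∈ Finset.Ioc ⌊x⌋₊ ⌊x + h⌋₊, φ m - ∫ y in x..x + h, φ y‖ := norm_add_le _ _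
    _ ≤ 1 + (L / x / 2 * (x + h - x) + (1 + 1) / 2) := add_le_add (hextra.trans hφfloor) hEM
    _ = L * h / (2 * x) + 2 := by field_simp; ring

/-- On the windows of the left-hand side the plateau of `g` is `1`: for `6X/5 ≤ x ≤ 2X`,
`0 ≤ h ≤ X/10` and `x ≤ m ≤ x + h`, `a_m = m^{-iL}`. [folklore] -/
theorem sum_aSeq_window {X L x h : ℝ} (hX : 0 < X) (hx1 : 6 / 5 * X ≤ x) (hx2 : x ≤ 2 * X)
    (hh : 0 ≤ h) (hhX : h ≤ X / 10) :
    ∑ m ∈ Finset.Icc ⌈x⌉₊ ⌊x + h⌋₊, aSeq X L m =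
      ∑ m ∈ Finset.Icc ⌈x⌉₊ ⌊x + h⌋₊, (m : ℂ) ^ (-((L : ℂ) * I)) := by
  refine Finset.sum_congr rfl fun m hm => ?_
  rw [Finset.mem_Icc] at hm
  have hm1 : x ≤ m := (Nat.le_ceil x).trans (by exact_mod_cast hm.1)
  have hm2 : (m : ℝ) ≤ x + h := le_trans (by exact_mod_cast hm.2) (Nat.floor_le (by linarith))
  unfold aSeq
  rw [g_eq_one, Complex.ofReal_one, one_mul]
  · rw [le_div_iff₀ hX]; linarith
  · rw [div_le_iff₀ hX]; linarith

/-- **Window approximation**: for `6X/5 ≤ x ≤ 2X`, `0 < h ≤ X/10`, `X ≥ 1`, `L > 0`,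
`‖h⁻¹ ∑_{x ≤ m ≤ x+h} a_m - x^{-iL} E(Lh/x)‖ ≤ L/(2x) + 2/h + L h²/x²`. [folklore] -/
theorem window_approx {X L x h : ℝ} (hL : 0 < L) (hx1 : 6 / 5 * X ≤ x)
    (hx2 : x ≤ 2 * X) (hh0 : 0 < h) (hhX : h ≤ X / 10) :
    ‖(h : ℂ)⁻¹ * ∑ m ∈ Finset.Icc ⌈x⌉₊ ⌊x + h⌋₊, aSeq X L m
        - (x : ℂ) ^ (-((L : ℂ) * I)) * E (L * h / x)‖ ≤ L / (2 * x) + 2 / h + L * h ^ 2 / x ^ 2 := by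
  have hX0 : 0 < X := by linarith
  have hx0 : 0 < x := by linarith
  have hhc : (h : ℂ) ≠ 0 := ofReal_ne_zero.2 hh0.ne'
  rw [sum_aSeq_window hX0 hx1 hx2 hh0.le hhX]
  set S := ∑ m ∈ Finset.Icc ⌈x⌉₊ ⌊x + h⌋₊, (m : ℂ) ^ (-((L : ℂ) * I)) with hS
  set Iint := ∫ y in x..x + h, (y : ℂ) ^ (-((L : ℂ) * I)) with hI
  set M := (x : ℂ) ^ (-((L : ℂ) * I)) * (h * E (L * h / x)) with hM
  have h1 : ‖S - Iint‖ ≤ L * h / (2 * x) + 2 := norm_sum_cpow_sub_integral_le hx0 hh0.le hL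
  have h2 : ‖Iint - M‖ ≤ L * h ^ 3 / x ^ 2 := norm_integral_cpow_sub_main_le hx0 hh0.le hL.le
  have hkey : (h : ℂ)⁻¹ * S - (x : ℂ) ^ (-((L : ℂ) * I)) * E (L * h / x) = (h : ℂ)⁻¹ * (S - M) := by
    simp only [hM]; field_simp
  rw [hkey, norm_mul, norm_inv, Complex.norm_real, Real.norm_eq_abs, abs_of_pos hh0]
  have h3 : ‖S - M‖ ≤ L * h / (2 * x) + 2 + L * h ^ 3 / x ^ 2 := by
    calc ‖S - M‖ = ‖(S - Iint) + (Iint - M)‖ := by rw [sub_add_sub_cancel]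
      _ ≤ ‖S - Iint‖ + ‖Iint - M‖ := norm_add_le _ _
      _ ≤ _ := add_le_add h1 h2
  calc h⁻¹ * ‖S - M‖ ≤ h⁻¹ * (L * h / (2 * x) + 2 + L * h ^ 3 / x ^ 2) :=
        mul_le_mul_of_nonneg_left h3 (inv_nonneg.2 hh0.le)
    _ = L / (2 * x) + 2 / h + L * h ^ 2 / x ^ 2 := by field_simp

/-- **The short-minus-long difference is large pointwise**: with `λ ≥ 200`, `X ≥ λ^{10}`,
`h₁ = X/(400λ)`, `h₂ = X/λ`, `L = 20λ`, for every `6X/5 ≤ x ≤ 2X`,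
`‖S₁(x)/h₁ - S₂(x)/h₂‖ ≥ 1/2` (the two windows carry the phases `E(X/(20x))`, of modulus
`≥ 23/24`, and `E(20X/x)`, of modulus `≤ 1/5`). [folklore] -/
theorem norm_D_ge {lam X x : ℝ} (hlam : 200 ≤ lam) (hX : lam ^ 10 ≤ X) (hx1 : 6 / 5 * X ≤ x)
    (hx2 : x ≤ 2 * X) :
    1 / 2 ≤ ‖((X / (400 * lam) : ℝ) : ℂ)⁻¹ *
          ∑ m ∈ Finset.Icc ⌈x⌉₊ ⌊x + X / (400 * lam)⌋₊, aSeq X (20 * lam) m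
        - ((X / lam : ℝ) : ℂ)⁻¹ * ∑ m ∈ Finset.Icc ⌈x⌉₊ ⌊x + X / lam⌋₊, aSeq X (20 * lam) m‖ := by
  have hlam1 : 1 ≤ lam := by linarith
  have hlam0 : 0 < lam := by linarith
  have hX1 : 1 ≤ X := le_trans (one_le_pow₀ hlam1) hX
  have hX0 : 0 < X := by linarith
  have hx0 : 0 < x := by linarith
  have hXx : X ≤ x := by linarith
  obtain ⟨h₁, hh₁⟩ : ∃ h₁ : ℝ, h₁ = X / (400 * lam) := ⟨_, rfl⟩
  obtain ⟨h₂, hh₂⟩ : ∃ h₂ : ℝ, h₂ = X / lam := ⟨_, rfl⟩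
  obtain ⟨L, hL⟩ : ∃ L : ℝ, L = 20 * lam := ⟨_, rfl⟩
  rw [← hh₁, ← hh₂, ← hL]
  have hh₁0 : 0 < h₁ := by rw [hh₁]; positivity
  have hh₂0 : 0 < h₂ := by rw [hh₂]; positivity
  have hL0 : 0 < L := by rw [hL]; positivity
  have hh₁X : h₁ ≤ X / 10 := by
    rw [hh₁, div_le_div_iff₀ (by positivity) (by norm_num)]; nlinarith
  have hh₂X : h₂ ≤ X / 10 := by
    rw [hh₂, div_le_div_iff₀ hlam0 (by norm_num)]; nlinarith
  -- the two window approximations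
  have e1 := window_approx (X := X) hL0 hx1 hx2 hh₁0 hh₁X
  have e2 := window_approx (X := X) hL0 hx1 hx2 hh₂0 hh₂X
  -- the phases
  have hθ₁ : L * h₁ / x = X / (20 * x) := by rw [hL, hh₁]; field_simp; ring
  have hθ₂ : L * h₂ / x = 20 * X / x := by rw [hL, hh₂]; field_simp
  have hθ₁0 : 0 ≤ X / (20 * x) := by positivity
  have hθ₁le : X / (20 * x) ≤ 1 / 24 := by
    rw [div_le_div_iff₀ (by positivity) (by norm_num)]; linarith
  have hθ₂0 : 0 < 20 * X / x := by positivity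
  have hE1 : 23 / 24 ≤ ‖E (L * h₁ / x)‖ := by
    rw [hθ₁]; have := one_sub_le_norm_E hθ₁0; linarith
  have hE2 : ‖E (L * h₂ / x)‖ ≤ 1 / 5 := by
    rw [hθ₂]
    refine (norm_E_le hθ₂0).trans ?_
    rw [div_div_eq_mul_div, div_le_div_iff₀ (by positivity) (by norm_num)]; linarith
  -- the error terms, as multiples of `lam / X` and `1 / lam`
  have hsq : X ^ 2 ≤ x ^ 2 := pow_le_pow_left₀ hX0.le hXx 2
  have i1 : L / (2 * x) ≤ 10 * (lam / X) := by
    rw [hL, show 20 * lam / (2 * x) = 10 * (lam / x) by ring]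
    exact mul_le_mul_of_nonneg_left (div_le_div_of_nonneg_left hlam0.le hX0 hXx) (by norm_num)
  have i2 : 2 / h₁ = 800 * (lam / X) := by rw [hh₁]; field_simp; ring
  have i3 : L * h₁ ^ 2 / x ^ 2 ≤ (1 / 8000) * (1 / lam) := by
    calc L * h₁ ^ 2 / x ^ 2 ≤ L * h₁ ^ 2 / X ^ 2 :=
          div_le_div_of_nonneg_left (by positivity) (by positivity) hsq
      _ = (1 / 8000) * (1 / lam) := by rw [hL, hh₁]; field_simp; ring
  have i4 : 2 / h₂ = 2 * (lam / X) := by rw [hh₂]; field_simp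
  have i5 : L * h₂ ^ 2 / x ^ 2 ≤ 20 * (1 / lam) := by
    calc L * h₂ ^ 2 / x ^ 2 ≤ L * h₂ ^ 2 / X ^ 2 :=
          div_le_div_of_nonneg_left (by positivity) (by positivity) hsq
      _ = 20 * (1 / lam) := by rw [hL, hh₂]; field_simp
  have i6 : lam / X ≤ 1 / 82200 := by
    have h9 : (82200 : ℝ) ≤ lam ^ 9 := le_trans (by norm_num) (pow_le_pow_left₀ (by norm_num) hlam 9)
    have h10 : lam * 82200 ≤ X := by
      calc lam * 82200 ≤ lam * lam ^ 9 := mul_le_mul_of_nonneg_left h9 hlam0.le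
        _ = lam ^ 10 := by ring
        _ ≤ X := hX
    rw [div_le_div_iff₀ hX0 (by norm_num)]; linarith
  have i7 : 1 / lam ≤ 1 / 200 := one_div_le_one_div_of_le (by norm_num) hlam
  -- the decomposition
  set T₁ := (h₁ : ℂ)⁻¹ * ∑ m ∈ Finset.Icc ⌈x⌉₊ ⌊x + h₁⌋₊, aSeq X L m with hT₁
  set T₂ := (h₂ : ℂ)⁻¹ * ∑ m ∈ Finset.Icc ⌈x⌉₊ ⌊x + h₂⌋₊, aSeq X L m with hT₂
  set xc := (x : ℂ) ^ (-((L : ℂ) * I)) with hxc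
  set E₁ := E (L * h₁ / x) with hE₁
  set E₂ := E (L * h₂ / x) with hE₂
  have hnxc : ‖xc‖ = 1 := by
    rw [hxc, Complex.norm_cpow_eq_rpow_re_of_pos hx0]; simp
  have hC : 23 / 24 - 1 / 5 ≤ ‖xc * (E₁ - E₂)‖ := by
    rw [norm_mul, hnxc, one_mul]
    have := norm_sub_norm_le E₁ E₂
    linarith
  have hdecomp : xc * (E₁ - E₂) = (T₁ - T₂) - (T₁ - xc * E₁) + (T₂ - xc * E₂) := by ring
  have hle : ‖xc * (E₁ - E₂)‖ ≤ ‖T₁ - T₂‖ + ‖T₁ - xc * E₁‖ + ‖T₂ - xc * E₂‖ := by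
    rw [hdecomp]
    exact (norm_add_le _ _).trans (add_le_add (norm_sub_le _ _) le_rfl)
  linarith [e1, e2, i1, i2, i3, i4, i5, i6, i7, hC, hle]

/-- `#(ℤ ∩ [x, x + h]) ≤ h + 1` for `x, h ≥ 0` (the same elementary count as
`Literature.NumberTheory.LFunctions.Tao2016.card_Icc_ceil_floor_le`, restated here to keep the import
cone of this file small). [folklore] -/
theorem card_Icc_ceil_floor_le {x h : ℝ} (hx : 0 ≤ x) (hh : 0 ≤ h) :
    (#(Finset.Icc ⌈x⌉₊ ⌊x + h⌋₊) : ℝ) ≤ h + 1 := by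
  rw [Nat.card_Icc]
  rcases le_or_gt ⌈x⌉₊ (⌊x + h⌋₊ + 1) with hle | hlt
  · rw [Nat.cast_sub hle]
    push_cast
    have h1 : (⌊x + h⌋₊ : ℝ) ≤ x + h := Nat.floor_le (by linarith)
    have h2 : x ≤ (⌈x⌉₊ : ℝ) := Nat.le_ceil x
    linarith
  · rw [Nat.sub_eq_zero_of_le hlt.le]; push_cast; linarith

/-- A short average of a `1`-bounded sequence is bounded by `1 + 1/h`. [folklore] -/
theorem norm_avg_le {a : ℕ → ℂ} (ha : ∀ m, ‖a m‖ ≤ 1) {x h : ℝ} (hx : 0 ≤ x) (hh : 0 < h) :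
    ‖(h : ℂ)⁻¹ * ∑ m ∈ Finset.Icc ⌈x⌉₊ ⌊x + h⌋₊, a m‖ ≤ 1 + 1 / h := by
  rw [norm_mul, norm_inv, Complex.norm_real, Real.norm_eq_abs, abs_of_pos hh]
  have h1 : ‖∑ m ∈ Finset.Icc ⌈x⌉₊ ⌊x + h⌋₊, a m‖ ≤ h + 1 := by
    refine (norm_sum_le _ _).trans ?_
    refine (Finset.sum_le_sum fun m _ => ha m).trans ?_
    rw [Finset.sum_const, nsmul_eq_mul, mul_one]
    exact card_Icc_ceil_floor_le hx hh.le
  calc h⁻¹ * ‖∑ m ∈ Finset.Icc ⌈x⌉₊ ⌊x + h⌋₊, a m‖ ≤ h⁻¹ * (h + 1) :=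
        mul_le_mul_of_nonneg_left h1 (inv_nonneg.2 hh.le)
    _ = 1 + 1 / h := by field_simp

/-- The difference of the two short averages, as a function of real `x`:
`D(x) = h₁⁻¹ ∑_{x ≤ m ≤ x+h₁} a_m - h₂⁻¹ ∑_{x ≤ m ≤ x+h₂} a_m`. [folklore] -/
def Dfun (a : ℕ → ℂ) (h₁ h₂ : ℝ) (x : ℝ) : ℂ :=
  (h₁ : ℂ)⁻¹ * ∑ m ∈ Finset.Icc ⌈x⌉₊ ⌊x + h₁⌋₊, a m
    - (h₂ : ℂ)⁻¹ * ∑ m ∈ Finset.Icc ⌈x⌉₊ ⌊x + h₂⌋₊, a m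

/-- The combinatorial part of `Dfun`, on the countable space `ℕ × ℕ × ℕ`. [folklore] -/
def Ffun (a : ℕ → ℂ) (h₁ h₂ : ℝ) (p : ℕ × ℕ × ℕ) : ℂ :=
  (h₁ : ℂ)⁻¹ * ∑ m ∈ Finset.Icc p.1 p.2.1, a m
    - (h₂ : ℂ)⁻¹ * ∑ m ∈ Finset.Icc p.1 p.2.2, a m

/-- `x ↦ (⌈x⌉, ⌊x + h₁⌋, ⌊x + h₂⌋)`. [folklore] -/
def tfun (h₁ h₂ : ℝ) (x : ℝ) : ℕ × ℕ × ℕ := (⌈x⌉₊, ⌊x + h₁⌋₊, ⌊x + h₂⌋₊)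

/-- `D = F ∘ t`. [folklore] -/
theorem Dfun_eq (a : ℕ → ℂ) (h₁ h₂ : ℝ) : Dfun a h₁ h₂ = Ffun a h₁ h₂ ∘ tfun h₁ h₂ := by
  funext x
  simp only [Function.comp_apply, Dfun, Ffun, tfun]

/-- `t` is measurable (`⌈·⌉`, `⌊·⌋` are). [folklore] -/
theorem measurable_tfun (h₁ h₂ : ℝ) : Measurable (tfun h₁ h₂) := by
  unfold tfun
  exact Nat.measurable_ceil.prodMk ((Nat.measurable_floor.comp (measurable_id.add_const h₁)).prodMk
      (Nat.measurable_floor.comp (measurable_id.add_const h₂)))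

/-- `D` is measurable (it factors through the measurable map `x ↦ (⌈x⌉, ⌊x+h₁⌋, ⌊x+h₂⌋)` into a
countable discrete space). [folklore] -/
theorem measurable_Dfun (a : ℕ → ℂ) (h₁ h₂ : ℝ) : Measurable (Dfun a h₁ h₂) := by
  rw [Dfun_eq]
  exact (measurable_of_countable (Ffun a h₁ h₂)).comp (measurable_tfun h₁ h₂)

/-- `‖D(x)‖ ≤ 4` for `x ≥ 0`, `h₁, h₂ ≥ 1`, `|a_m| ≤ 1`. [folklore] -/
theorem norm_Dfun_le {a : ℕ → ℂ} (ha : ∀ m, ‖a m‖ ≤ 1) {h₁ h₂ x : ℝ} (hh₁ : 1 ≤ h₁)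
    (hh₂ : 1 ≤ h₂) (hx : 0 ≤ x) : ‖Dfun a h₁ h₂ x‖ ≤ 4 := by
  have hh₁0 : 0 < h₁ := by linarith
  have hh₂0 : 0 < h₂ := by linarith
  have hb1 := norm_avg_le ha hx hh₁0
  have hb2 := norm_avg_le ha hx hh₂0
  have hi1 : 1 / h₁ ≤ 1 := by rw [div_le_one hh₁0]; exact hh₁
  have hi2 : 1 / h₂ ≤ 1 := by rw [div_le_one hh₂0]; exact hh₂
  calc ‖Dfun a h₁ h₂ x‖ ≤ ‖(h₁ : ℂ)⁻¹ * ∑ m ∈ Finset.Icc ⌈x⌉₊ ⌊x + h₁⌋₊, a m‖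
        + ‖(h₂ : ℂ)⁻¹ * ∑ m ∈ Finset.Icc ⌈x⌉₊ ⌊x + h₂⌋₊, a m‖ := norm_sub_le _ _
    _ ≤ (1 + 1 / h₁) + (1 + 1 / h₂) := add_le_add hb1 hb2
    _ ≤ 4 := by linarith

/-- `|D|²` is integrable on every `[a', b'] ⊂ [0, ∞)`. [folklore] -/
theorem intervalIntegrable_normSq_Dfun {a : ℕ → ℂ} (ha : ∀ m, ‖a m‖ ≤ 1) {h₁ h₂ : ℝ}
    (hh₁ : 1 ≤ h₁) (hh₂ : 1 ≤ h₂) {a' b' : ℝ} (ha' : 0 ≤ a') (hab : a' ≤ b') :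
    IntervalIntegrable (fun x => ‖Dfun a h₁ h₂ x‖ ^ 2) volume a' b' := by
  refine (intervalIntegrable_const (c := (16 : ℝ))).mono_fun'
    ((measurable_Dfun a h₁ h₂).norm.pow_const 2).aestronglyMeasurable ?_
  refine (ae_restrict_mem measurableSet_uIoc).mono fun x hx => ?_
  rw [Set.uIoc_of_le hab] at hx
  dsimp only
  rw [Real.norm_eq_abs, abs_of_nonneg (sq_nonneg _)]
  have h4 := norm_Dfun_le ha hh₁ hh₂ (ha'.trans hx.1.le)
  nlinarith [norm_nonneg (Dfun a h₁ h₂ x)]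

/-- **The left-hand side of Lemma 14 is large for the test sequence**: with `λ ≥ 200`,
`X ≥ λ^{10}`, `h₁ = X/(400λ)`, `h₂ = X/λ`,
`X⁻¹ ∫_X^{2X} |S₁(x)/h₁ - S₂(x)/h₂|² dx ≥ 1/5`. [folklore] -/
theorem lhs_ge {lam X : ℝ} (hlam : 200 ≤ lam) (hX : lam ^ 10 ≤ X) :
    1 / 5 ≤ X⁻¹ * ∫ x in X..2 * X,
      ‖((X / (400 * lam) : ℝ) : ℂ)⁻¹ *
            ∑ m ∈ Finset.Icc ⌈x⌉₊ ⌊x + X / (400 * lam)⌋₊, aSeq X (20 * lam) m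
          - ((X / lam : ℝ) : ℂ)⁻¹ *
            ∑ m ∈ Finset.Icc ⌈x⌉₊ ⌊x + X / lam⌋₊, aSeq X (20 * lam) m‖ ^ 2 := by
  have hlam1 : 1 ≤ lam := by linarith
  have hlam0 : 0 < lam := by linarith
  have hX1 : 1 ≤ X := le_trans (one_le_pow₀ hlam1) hX
  have hX0 : 0 < X := by linarith
  change 1 / 5 ≤ X⁻¹ * ∫ x in X..2 * X, ‖Dfun (aSeq X (20 * lam)) (X / (400 * lam)) (X / lam) x‖ ^ 2
  -- pointwise lower bound on `[6X/5, 2X]`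
  have hpt : ∀ x ∈ Icc (6 / 5 * X) (2 * X),
      (1 / 4 : ℝ) ≤ ‖Dfun (aSeq X (20 * lam)) (X / (400 * lam)) (X / lam) x‖ ^ 2 := by
    intro x hx
    have h := norm_D_ge hlam hX hx.1 hx.2
    change 1 / 2 ≤ ‖Dfun (aSeq X (20 * lam)) (X / (400 * lam)) (X / lam) x‖ at h
    nlinarith [h]
  -- integrability
  have h3 : lam ^ 3 ≤ lam ^ 10 := pow_le_pow_right₀ hlam1 (by norm_num)
  have hl2 : (40000 : ℝ) ≤ lam ^ 2 := by nlinarith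
  have hl3 : 40000 * lam ≤ lam ^ 3 :=
    (mul_le_mul_of_nonneg_right hl2 hlam0.le).trans_eq (by ring)
  have hh₁1 : 1 ≤ X / (400 * lam) := by
    rw [le_div_iff₀ (by positivity)]; nlinarith
  have hh₂1 : 1 ≤ X / lam := by
    rw [le_div_iff₀ hlam0]; nlinarith
  have hint : ∀ a' b' : ℝ, 0 ≤ a' → a' ≤ b' → IntervalIntegrable
      (fun x => ‖Dfun (aSeq X (20 * lam)) (X / (400 * lam)) (X / lam) x‖ ^ 2) volume a' b' :=
    fun a' b' ha' hab => intervalIntegrable_normSq_Dfun (norm_aSeq_le X (20 * lam)) hh₁1 hh₂1 ha' hab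
  -- the lower bound
  have hX65 : X ≤ 6 / 5 * X := by linarith
  have h65 : 6 / 5 * X ≤ 2 * X := by linarith
  have hsecond : ∫ x in (6 / 5 * X)..2 * X, (1 / 4 : ℝ) ≤
      ∫ x in (6 / 5 * X)..2 * X, ‖Dfun (aSeq X (20 * lam)) (X / (400 * lam)) (X / lam) x‖ ^ 2 :=
    intervalIntegral.integral_mono_on h65 intervalIntegrable_const
      (hint (6 / 5 * X) (2 * X) (by positivity) h65) fun x hx => hpt x hx
  rw [intervalIntegral.integral_const, smul_eq_mul] at hsecond
  have hfirst : 0 ≤ ∫ x in X..6 / 5 * X,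
      ‖Dfun (aSeq X (20 * lam)) (X / (400 * lam)) (X / lam) x‖ ^ 2 :=
    intervalIntegral.integral_nonneg hX65 fun x _ => sq_nonneg _
  have hsplit := intervalIntegral.integral_add_adjacent_intervals (hint X (6 / 5 * X) hX0.le hX65)
    (hint (6 / 5 * X) (2 * X) (by positivity) h65)
  have htotal : X / 5 ≤
      ∫ x in X..2 * X, ‖Dfun (aSeq X (20 * lam)) (X / (400 * lam)) (X / lam) x‖ ^ 2 := by
    rw [← hsplit]; linarith
  have e : (1 / 5 : ℝ) = X⁻¹ * (X / 5) := by field_simp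
  rw [e]
  exact mul_le_mul_of_nonneg_left htotal (inv_nonneg.2 hX0.le)

/-! ### Reformulation of the two sides and the choice of parameters -/

/-- The left-hand side of Lemma 14, `X⁻¹ ∫_X^{2X} |S₁(x)/h₁ - S₂(x)/h₂|² dx`.
[cite: MatomakiRadziwillAnnals2016, Lemma 14] -/
def lhsL14 (a : ℕ → ℂ) (X h₁ h₂ : ℝ) : ℝ :=
  X⁻¹ * ∫ x in X..2 * X, ‖(h₁ : ℂ)⁻¹ * ∑ m ∈ Finset.Icc ⌈x⌉₊ ⌊x + h₁⌋₊, a m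
    - (h₂ : ℂ)⁻¹ * ∑ m ∈ Finset.Icc ⌈x⌉₊ ⌊x + h₂⌋₊, a m‖ ^ 2

/-- The bracket on the right-hand side of `MatomakiRadziwill2016_lemma14` (mis-parenthesised as
vendored: the `max` term sits inside the first integral), with `ℓ = (log X)^{2/15}` and
`T₀ = (log X)^{1/15}` as parameters. [cite: MatomakiRadziwillAnnals2016, Lemma 14] -/
def rhsL14 (a : ℕ → ℂ) (X h₁ T₀ ℓ : ℝ) : ℝ :=
  1 / ℓ + ∫ t in T₀..X / h₁, (Nsq a X t + Smax a X h₁)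

-- `MatomakiRadziwill2016_lemma14` is `@[deprecated]` (mis-stated, refuted here; 2026-08-15) and this unfolding must
-- name it; REMOVE-WHEN the deprecated def is deleted from `MatomakiRadziwill.lean`.
set_option linter.deprecated false in
/-- `MatomakiRadziwill2016_lemma14`, unfolded through `lhsL14` / `rhsL14` (definitional).
[cite: MatomakiRadziwillAnnals2016, Lemma 14] -/
theorem lemma14_iff : MatomakiRadziwill2016_lemma14 ↔
    ∃ C X₀ : ℝ, ∀ a : ℕ → ℂ, (∀ m, ‖a m‖ ≤ 1) →
      ∀ X h₁ : ℝ, X₀ ≤ X → 1 ≤ h₁ → h₁ ≤ X / Real.log X ^ (1 / 5 : ℝ) →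
        lhsL14 a X h₁ (X / Real.log X ^ (1 / 5 : ℝ)) ≤
          C * rhsL14 a X h₁ (Real.log X ^ (1 / 15 : ℝ)) (Real.log X ^ (2 / 15 : ℝ)) :=
  Iff.rfl

/-- `lhs_ge` in terms of `lhsL14`. [folklore] -/
theorem lhsL14_ge {lam X : ℝ} (hlam : 200 ≤ lam) (hX : lam ^ 10 ≤ X) :
    1 / 5 ≤ lhsL14 (aSeq X (20 * lam)) X (X / (400 * lam)) (X / lam) :=
  lhs_ge hlam hX

/-- `rhs_integral_le` in terms of `rhsL14`. [folklore] -/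
theorem rhsL14_le {B₁ B₂ : ℝ} (hB₁0 : 0 ≤ B₁) (hB₂0 : 0 ≤ B₂) (hB₁ : ∀ u, |deriv g u| ≤ B₁)
    (hB₂ : ∀ u, |deriv (deriv g) u| ≤ B₂) {lam X T₀ ℓ : ℝ} (hlam : 1 ≤ lam)
    (hX : lam ^ 10 ≤ X) (hT₀ : 0 ≤ T₀) (hT₀' : T₀ ≤ 400 * lam) :
    rhsL14 (aSeq X (20 * lam)) X (X / (400 * lam)) T₀ ℓ ≤
      1 / ℓ + 10 ^ 9 * (B₁ + B₂ + 1) ^ 2 / lam := by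
  have hX0 : 0 < X := lt_of_lt_of_le (by positivity) hX
  have hXh₁ : X / (X / (400 * lam)) = 400 * lam := by field_simp
  unfold rhsL14
  exact add_le_add le_rfl (rhs_integral_le hB₁0 hB₂0 hB₁ hB₂ hlam hX hT₀ hT₀' hXh₁)

/-- The right-hand side is nonnegative. [folklore] -/
theorem rhsL14_nonneg {lam X T₀ ℓ : ℝ} (hlam : 1 ≤ lam) (hX : lam ^ 10 ≤ X) (hT₀' : T₀ ≤ 400 * lam)
    (hℓ : 0 < ℓ) : 0 ≤ rhsL14 (aSeq X (20 * lam)) X (X / (400 * lam)) T₀ ℓ := by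
  have hX0 : 0 < X := lt_of_lt_of_le (by positivity) hX
  have hXh₁ : X / (X / (400 * lam)) = 400 * lam := by field_simp
  unfold rhsL14
  refine add_nonneg (by positivity) ?_
  rw [hXh₁]
  have hS0 : 0 ≤ Smax (aSeq X (20 * lam)) X (X / (400 * lam)) :=
    Smax_nonneg _ (by rw [hXh₁]; positivity)
  exact intervalIntegral.integral_nonneg hT₀' fun t _ => add_nonneg (Nsq_nonneg _ _ _) hS0

/-- `exp(λ⁵) ≥ λ^{10}` for `λ ≥ 2` (from `y³/3! ≤ e^y`). [folklore] -/
theorem pow_ten_le_exp_pow_five {lam : ℝ} (hlam : 2 ≤ lam) : lam ^ 10 ≤ Real.exp (lam ^ 5) := by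
  have h := Real.pow_div_factorial_le_exp (x := lam ^ 5) (by positivity) 3
  have h3 : ((Nat.factorial 3 : ℕ) : ℝ) = 6 := by norm_num [Nat.factorial]
  rw [h3] at h
  have h5 : (32 : ℝ) ≤ lam ^ 5 := le_trans (by norm_num) (pow_le_pow_left₀ (by norm_num) hlam 5)
  have h10 : lam ^ 10 ≤ (lam ^ 5) ^ 3 / 6 := by
    rw [le_div_iff₀ (by norm_num : (0 : ℝ) < 6)]
    have : 0 ≤ lam ^ 10 := by positivity
    nlinarith
  exact h10.trans h

/-- The parameters are eventually admissible and make `C⁺ · (right-hand side bound)` small.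
[folklore] -/
theorem eventually_good (Cp K X₀ : ℝ) :
    ∀ᶠ lam : ℝ in atTop, 200 ≤ lam ∧ X₀ ≤ Real.exp (lam ^ 5) ∧
      Cp * (1 / (lam ^ 5) ^ (2 / 15 : ℝ) + K / lam) < 1 / 5 := by
  have h1 : ∀ᶠ lam : ℝ in atTop, 200 ≤ lam := eventually_ge_atTop _
  have h2 : ∀ᶠ lam : ℝ in atTop, X₀ ≤ Real.exp (lam ^ 5) :=
    (Real.tendsto_exp_atTop.comp (tendsto_pow_atTop (by norm_num))).eventually
      (eventually_ge_atTop X₀)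
  have h3 : Tendsto (fun lam : ℝ => Cp * (1 / (lam ^ 5) ^ (2 / 15 : ℝ) + K / lam)) atTop (𝓝 0) := by
    have ha : Tendsto (fun lam : ℝ => 1 / (lam ^ 5) ^ (2 / 15 : ℝ)) atTop (𝓝 0) :=
      tendsto_const_nhds.div_atTop
        ((tendsto_rpow_atTop (by norm_num)).comp (tendsto_pow_atTop (by norm_num)))
    have hb : Tendsto (fun lam : ℝ => K / lam) atTop (𝓝 0) :=
      tendsto_const_nhds.div_atTop tendsto_id
    simpa using (ha.add hb).const_mul Cp
  exact (h1.and h2).and (h3.eventually (gt_mem_nhds (by norm_num))) |>.mono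
    fun lam h => ⟨h.1.1, h.1.2, h.2⟩

end MatomakiRadziwillL14Refutation

-- `MatomakiRadziwill2016_lemma14` is `@[deprecated]` (mis-stated, refuted here; 2026-08-15) and its refutation must
-- name it; REMOVE-WHEN the deprecated def is deleted from `MatomakiRadziwill.lean`.
set_option linter.deprecated false in
open MatomakiRadziwillL14Refutation in
/-- **`MatomakiRadziwill2016_lemma14` is false.**  The vendored rendering of Matomäki–Radziwiłł's
Lemma 14 quantifies over *complex* sequences `|a_m| ≤ 1`, while its right-hand side only sees the
Dirichlet polynomial `A(1+it)` at the frequencies `t ≥ (log X)^{1/15}`.  For the sequence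
`a_m = g(m/X) m^{-iL}` (`g` a smooth plateau, `L = 20 (log X)^{1/5}`) and `h₁ = h₂/400`,
`h₂ = X/(log X)^{1/5}`, the short averages over `[x, x + h₁]` keep modulus `≈ 1` while those over
`[x, x + h₂]` cancel, so the left-hand side is `≥ 1/5` (`lhs_ge`); but `A(1+it)` is concentrated
near `t = -L < 0`, and the whole bracket on the right is `≪ (log X)^{-2/15} + (log X)^{-1/5}`
(`rhs_integral_le`), whatever the constant.  (The printed lemma is about real `a_m`, for which the
right-hand side is symmetric in `t`; that statement is `MatomakiRadziwill2016_lemma14_real`, proved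
in `MatomakiRadziwillLemma14.lean`.) [cite: MatomakiRadziwillAnnals2016, Lemma 14] -/
theorem MatomakiRadziwill2016_lemma14_false : ¬ MatomakiRadziwill2016_lemma14 := by
  rw [lemma14_iff]
  rintro ⟨C, X₀, H⟩
  obtain ⟨B₁, B₂, hB₁0, hB₂0, hB₁, hB₂⟩ := exists_deriv_bounds
  -- a constant `Cp ≥ max(C, 1)` and the parameter `λ`
  obtain ⟨Cp, hCp⟩ : ∃ Cp : ℝ, Cp = max C 1 := ⟨_, rfl⟩
  have hCp1 : 1 ≤ Cp := hCp ▸ le_max_right _ _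
  have hCCp : C ≤ Cp := hCp ▸ le_max_left _ _
  have hCp0 : 0 < Cp := by linarith
  obtain ⟨lam, h200, hX₀, hsmall⟩ :=
    (eventually_good Cp (10 ^ 9 * (B₁ + B₂ + 1) ^ 2) X₀).exists
  have hlam1 : 1 ≤ lam := by linarith
  have hlam2 : 2 ≤ lam := by linarith
  have hlam0 : 0 < lam := by linarith
  obtain ⟨X, hXdef⟩ : ∃ X : ℝ, X = Real.exp (lam ^ 5) := ⟨_, rfl⟩
  rw [← hXdef] at hX₀
  have hlogX : Real.log X = lam ^ 5 := by rw [hXdef, Real.log_exp]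
  have hX10 : lam ^ 10 ≤ X := hXdef ▸ pow_ten_le_exp_pow_five hlam2
  have hX0 : 0 < X := lt_of_lt_of_le (by positivity) hX10
  have hlam5 : (lam ^ 5) ^ (1 / 5 : ℝ) = lam := by
    rw [one_div]; exact Real.pow_rpow_inv_natCast hlam0.le (by norm_num)
  have hl5one : 1 ≤ lam ^ 5 := one_le_pow₀ hlam1
  -- `T₀ = (log X)^{1/15}` and `ℓ = (log X)^{2/15}`
  have hT₀0 : 0 ≤ (lam ^ 5) ^ (1 / 15 : ℝ) := by positivity
  have hT₀le : (lam ^ 5) ^ (1 / 15 : ℝ) ≤ 400 * lam := by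
    calc (lam ^ 5) ^ (1 / 15 : ℝ) ≤ (lam ^ 5) ^ (1 / 5 : ℝ) :=
          Real.rpow_le_rpow_of_exponent_le hl5one (by norm_num)
      _ = lam := hlam5
      _ ≤ 400 * lam := by linarith
  have hℓ : 0 < (lam ^ 5) ^ (2 / 15 : ℝ) := by positivity
  -- admissibility of `h₁ = X/(400 λ)`
  have hh₁1 : 1 ≤ X / (400 * lam) := by
    rw [le_div_iff₀ (by positivity)]
    have h3 : lam ^ 3 ≤ lam ^ 10 := pow_le_pow_right₀ hlam1 (by norm_num)
    have hl2 : (40000 : ℝ) ≤ lam ^ 2 := by nlinarith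
    have hl3 : 40000 * lam ≤ lam ^ 3 :=
      (mul_le_mul_of_nonneg_right hl2 hlam0.le).trans_eq (by ring)
    nlinarith
  have hh₁2 : X / (400 * lam) ≤ X / Real.log X ^ (1 / 5 : ℝ) := by
    rw [hlogX, hlam5]
    exact div_le_div_of_nonneg_left hX0.le hlam0 (by linarith)
  -- the fact, at the test sequence
  have key := H (aSeq X (20 * lam)) (norm_aSeq_le X (20 * lam)) X (X / (400 * lam)) hX₀ hh₁1 hh₁2
  rw [hlogX, hlam5] at key
  have l := lhsL14_ge h200 hX10
  have r := rhsL14_le hB₁0 hB₂0 hB₁ hB₂ hlam1 hX10 hT₀0 hT₀le (ℓ := (lam ^ 5) ^ (2 / 15 : ℝ))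
  have r0 := rhsL14_nonneg hlam1 hX10 hT₀le hℓ (T₀ := (lam ^ 5) ^ (1 / 15 : ℝ))
  obtain ⟨R, hR⟩ : ∃ R : ℝ, R = rhsL14 (aSeq X (20 * lam)) X (X / (400 * lam))
      ((lam ^ 5) ^ (1 / 15 : ℝ)) ((lam ^ 5) ^ (2 / 15 : ℝ)) := ⟨_, rfl⟩
  rw [← hR] at key r r0
  obtain ⟨ε, hε⟩ : ∃ ε : ℝ, ε = 1 / (lam ^ 5) ^ (2 / 15 : ℝ) + 10 ^ 9 * (B₁ + B₂ + 1) ^ 2 / lam :=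
    ⟨_, rfl⟩
  rw [← hε] at r hsmall
  have h1 : C * R ≤ Cp * R := mul_le_mul_of_nonneg_right hCCp r0
  have h2 : Cp * R ≤ Cp * ε := mul_le_mul_of_nonneg_left r hCp0.le
  linarith

-- the alias must name the deprecated def too; REMOVE-WHEN the deprecated def is deleted.
set_option linter.deprecated false in
/-- Conventional name (`not_<decl>`) of the refutation of the deprecated named fact
`MatomakiRadziwill2016_lemma14` (= `MatomakiRadziwill2016_lemma14_false`).
[cite: MatomakiRadziwillAnnals2016, Lemma 14] -/
theorem not_MatomakiRadziwill2016_lemma14 : ¬ MatomakiRadziwill2016_lemma14 :=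
  MatomakiRadziwill2016_lemma14_false

end Literature.NumberTheory.Sieve
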